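import Literature.Analysis.FunctionSpaces.SobolevDifferenceQuotients
import Literature.Analysis.FunctionSpaces.ConvexLipschitzDomain
import Literature.Analysis.FunctionSpaces.SobolevExtensionGlue
import Literature.Analysis.FunctionSpaces.SobolevTraceEmbeddingProofs
import Literature.Analysis.FluidPDE.Ferrari1993EnergyIdentity
import Mathlib.Analysis.Calculus.BumpFunction.InnerProduct
import HarnessLib

/-!
# Tangential `H²`-regularity at a flat boundary portion for weak solutions of the Neumann
# problem in divergence form (Nirenberg's difference quotients on a half-ball)

Topic `Analysis/PDE`. Theorem file (four auxiliary definitions — the open half-space, the open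
half-ball, and the cut-off test function `η² w` of Nirenberg's argument with its gradient, both
zero-extended — and one predicate `IsWeakNeumannHalfBall` packaging the weak formulation; no named
facts, everything proved) on the discharge path of
`Literature.Geometry.Riemannian.sharpLogSobolevAVR_four` (Balogh–Kristály–Tripaldi 2024, Thm. 1.1),
whose residual hypothesis (`sharpLogSobolevAVR_four_of_neumann`,
`Geometry/Riemannian/SharpLogSobolevAVRNeumann.lean`) is the smooth solvability of S. Brendle's
Neumann problem; this file is the first step of the boundary regularity of its weak solutions.

## Setting and statement

`H` is a finite-dimensional real inner product space with an additive Haar measure `μ`, `ν ∈ H` a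
(normal) vector, `z ∈ H`, `0 < R`; the **half-ball** `U_R = B(z,R) ∩ {⟪y - z, ν⟫ < 0}` has the flat
boundary portion `B(z,R) ∩ {⟪y - z, ν⟫ = 0}`. Coefficients `A : H → (H →L[ℝ] H)` of class `C¹`,
uniformly elliptic on `B(z,R)` (`λ‖ξ‖² ≤ ⟪A(y)ξ, ξ⟫`); data `F ∈ L²(U_R)`, `G ∈ W^{1,2}(U_R; H)`.
A **weak solution of the Neumann problem on the half-ball** (`IsWeakNeumannHalfBall`) is
`u ∈ W^{1,2}(U_R)` with weak gradient `∇u ∈ L²(U_R; H)` such that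

  `∫_{U_R} ⟪A ∇u, ∇ζ⟫ dμ = ∫_{U_R} (F ζ + ⟪G, ∇ζ⟫) dμ`

for every `ζ ∈ C_c^∞(B(z,R))` — test functions are NOT required to vanish on the flat part, which
encodes the natural (conormal / Neumann) boundary condition `⟪A∇u - G, ν⟫ = 0` there (Evans, *PDE*,
§6.3.2, remark after Theorem 4; Taylor, *PDE I*, Ch. 5, (7.22)–(7.24)).

**Theorem** (`IsWeakNeumannHalfBall.exists_hasWeakDerivAlong_tangential`; Evans §6.3.2, proof of
Theorem 4, steps 1–3 with the modification for the Neumann condition noted by Taylor, Ch. 5 §7,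
(7.25)–(7.30): "the tangential derivatives … are estimated exactly as in the Dirichlet case, since
the difference quotients `D^h_k u`, `k < n`, are admissible"): for `0 < r < R` and every tangential
direction `v` (`⟪v, ν⟫ = 0`), the weak gradient `∇u` has a weak derivative along `v` in
`L²(U_r; H)`.

## Proof (mirroring Evans §6.3.2, Thm. 4, and §6.3.1, Thm. 1)

With `δ = (R - r)/4`, a cut-off `η ∈ C_c^∞(B(z, r+δ))`, `η = 1` on `B(z,r)`, a unit tangential
`v` and `0 < |t| ≤ δ`, the function `ζ = -D^{-t}_v (η² D^t_v u)` (zero-extended to the half-space,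
`memSobolevDomain_indicator_smul` / `hasWeakFDerivOn_indicator_smul`) lies in `W^{1,2}` of the
half-space, is supported in `B̄(z, r+2δ)`, and is admissible in the weak formulation extended by
density (`smooth_upToBoundary_dense_holds` on the convex, hence Lipschitz, half-ball) to `W^{1,2}` test
functions supported in a smaller ball. The discrete integration by parts
(`setIntegral_inner_diffQuot_neg_eq`), the discrete Leibniz rule for `D^t_v (A ∇u)`, ellipticity at
the shifted points and the bound `‖D^t_v f‖_{L²} ≤ ‖∂_v f‖_{L²}` (`eLpNorm_diffQuot_le`, Evans §5.8.2
Thm. 3 (i)) give `λ X² ≤ α X + β` for `X = ‖η D^t_v ∇u‖_{L²}` with `α, β` independent of `t`,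
whence a uniform bound on `‖D^t_v ∇u‖_{L²(U_r)}`; Evans §5.8.2 Thm. 3 (ii)
(`exists_hasWeakDerivAlong_of_eLpNorm_diffQuot_le`, componentwise) yields the weak derivative.

## What is NOT here

The normal derivative (from the equation) and the `W^{2,2}(U_r)` membership, higher regularity,
the boundary flattening, and the existence of weak solutions — the next files of the programme.

## Mathlib / tree search

Tree: `SobolevDifferenceQuotients.lean` (the toolkit this file consumes), `HasWeakDerivAlong`
(`FluidPDE/WeakDerivAlong.lean`), `hasWeakFDerivOn_indicator_smul` (`SobolevExtensionGlue.lean`),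
`isLipschitzDomain_of_convex`, `smooth_upToBoundary_dense_holds`; the periodic-cylinder Neumann
files (`FluidPDE/PeriodicCylinderNeumann*.lean`) treat a different, specific geometry with smooth
solutions. Mathlib: no weak solutions of boundary value problems (grep of the tree and of Mathlib
for `Neumann`, `halfBall`, `half-ball`, `boundary regularity`: nothing relevant outside the files
named above).

## References

* L. C. Evans, *Partial Differential Equations*, 2nd ed., AMS (2010), §6.3.1 Theorem 1, §6.3.2
  Theorem 4 (boundary `H²`-regularity), §5.8.2 Theorem 3. [Evans2010]
* M. E. Taylor, *Partial Differential Equations I*, 2nd ed., Springer (2011), Ch. 5, §7,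
  Propositions 7.1–7.2 and (7.22)–(7.30) (regularity for the Neumann problem). [TaylorPDEI2011]
* L. Nirenberg, *Remarks on strongly elliptic partial differential equations*, Comm. Pure Appl.
  Math. 8 (1955) 649–675. [folklore]
-/

noncomputable section

open MeasureTheory TopologicalSpace Set Function Filter Topology InnerProductSpace Metric
open scoped RealInnerProductSpace ENNReal NNReal ContDiff

namespace Literature.Analysis.PDE

open Literature.Analysis.FunctionSpaces Literature.Analysis.FluidPDE SobolevApprox

/-! ### `L²` bookkeeping with real `L²` sizes (Cauchy–Schwarz is the tree's `abs_integral_inner_le`) -/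

section L2

variable {α : Type*} [MeasurableSpace α] {μ : Measure α}
variable {F' : Type*} [NormedAddCommGroup F'] [InnerProductSpace ℝ F']

/-- **Cauchy–Schwarz in `L²`, real functions**: `|∫ f g| ≤ ‖f‖_{L²} ‖g‖_{L²}` (from the tree's
`abs_integral_inner_le`). [folklore] -/
private theorem abs_integral_mul_le_L2 {f g : α → ℝ} (hf : MemLp f 2 μ) (hg : MemLp g 2 μ) :
    |∫ x, f x * g x ∂μ| ≤ (eLpNorm f 2 μ).toReal * (eLpNorm g 2 μ).toReal := by
  have h := abs_integral_inner_le hf hg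
  simpa only [RCLike.inner_apply, conj_trivial, mul_comm] using h

omit [InnerProductSpace ℝ F'] in
/-- A pointwise bound `‖f‖ ≤ C ‖g‖` a.e. gives `‖f‖_{L²} ≤ C ‖g‖_{L²}` for the real sizes.
[folklore] -/
theorem toReal_eLpNorm_le_mul_of_ae_le {G' : Type*} [NormedAddCommGroup G'] {f : α → F'}
    {g : α → G'} (hg : MemLp g 2 μ) {C : ℝ} (hC : 0 ≤ C) (h : ∀ᵐ x ∂μ, ‖f x‖ ≤ C * ‖g x‖) :
    (eLpNorm f 2 μ).toReal ≤ C * (eLpNorm g 2 μ).toReal := by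
  have h1 : eLpNorm f 2 μ ≤ ENNReal.ofReal C * eLpNorm g 2 μ :=
    eLpNorm_le_mul_eLpNorm_of_ae_le_mul h 2
  calc (eLpNorm f 2 μ).toReal ≤ (ENNReal.ofReal C * eLpNorm g 2 μ).toReal :=
        ENNReal.toReal_mono (ENNReal.mul_ne_top ENNReal.ofReal_ne_top hg.eLpNorm_ne_top) h1
    _ = C * (eLpNorm g 2 μ).toReal := by rw [ENNReal.toReal_mul, ENNReal.toReal_ofReal hC]

omit [InnerProductSpace ℝ F'] in
/-- Triangle inequality for the real `L²` sizes. [folklore] -/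
theorem toReal_eLpNorm_add_le [NormedSpace ℝ F'] {f g : α → F'} (hf : MemLp f 2 μ)
    (hg : MemLp g 2 μ) :
    (eLpNorm (f + g) 2 μ).toReal ≤ (eLpNorm f 2 μ).toReal + (eLpNorm g 2 μ).toReal := by
  rw [← ENNReal.toReal_add hf.eLpNorm_ne_top hg.eLpNorm_ne_top]
  exact ENNReal.toReal_mono (ENNReal.add_ne_top.2 ⟨hf.eLpNorm_ne_top, hg.eLpNorm_ne_top⟩)
    (eLpNorm_add_le hf.1 hg.1 (by norm_num))

omit [InnerProductSpace ℝ F'] in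
/-- If `f` vanishes on `T \ S` (`S ⊆ T` measurable), its `L^p` sizes on `S` and `T` agree. [folklore] -/
theorem eLpNorm_restrict_eq_of_forall_eq_zero {S T : Set α} (hS : MeasurableSet S)
    (hT : MeasurableSet T) (hST : S ⊆ T) {f : α → F'} (h : ∀ x ∈ T, x ∉ S → f x = 0) (p : ℝ≥0∞) :
    eLpNorm f p (μ.restrict T) = eLpNorm f p (μ.restrict S) := by
  have e : ∀ᵐ x ∂(μ.restrict T), f x = S.indicator f x := by
    rw [ae_restrict_iff' hT]
    refine Eventually.of_forall fun x hx => ?_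
    by_cases hxS : x ∈ S
    · rw [indicator_of_mem hxS]
    · rw [indicator_of_notMem hxS, h x hx hxS]
  rw [eLpNorm_congr_ae e, eLpNorm_indicator_eq_eLpNorm_restrict hS, Measure.restrict_restrict hS,
    inter_eq_self_of_subset_left hST]

omit [InnerProductSpace ℝ F'] in
/-- A function in `L^p(S)` vanishing on `T ∖ S` lies in `L^p(T)` (`S ⊆ T` measurable). [folklore] -/
theorem memLp_of_forall_sdiff_eq_zero [NormedSpace ℝ F'] {S T : Set α} (hS : MeasurableSet S)
    (hT : MeasurableSet T) (hST : S ⊆ T) {f : α → F'} {p : ℝ≥0∞} (hf : MemLp f p (μ.restrict S))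
    (h0 : ∀ x ∈ T, x ∉ S → f x = 0) : MemLp f p (μ.restrict T) := by
  have e : f =ᵐ[μ.restrict T] S.indicator f := by
    rw [EventuallyEq, ae_restrict_iff' hT]
    refine Eventually.of_forall fun x hx => ?_
    by_cases hxS : x ∈ S
    · rw [indicator_of_mem hxS]
    · rw [indicator_of_notMem hxS, h0 x hx hxS]
  refine (memLp_congr_ae e).2 ((memLp_indicator_iff_restrict hS).2 ?_)
  rwa [Measure.restrict_restrict hS, inter_eq_self_of_subset_left hST]

/-- The inner product of two `L²` fields is integrable. [folklore] -/
theorem integrable_inner_of_memLp_two {f g : α → F'} (hf : MemLp f 2 μ) (hg : MemLp g 2 μ) :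
    Integrable (fun x => ⟪f x, g x⟫) μ :=
  memLp_one_iff_integrable.1 (MemLp.of_bilin (fun a b => ⟪a, b⟫) 1 hf hg (hf.1.inner hg.1)
    (Eventually.of_forall fun x => by simpa using nnnorm_inner_le_nnnorm (f x) (g x)))

end L2

/-! ### The half-space and the half-ball -/

section Geometry

variable {H : Type*} [NormedAddCommGroup H] [InnerProductSpace ℝ H]

/-- The open half-space `{y | ⟪y - z, ν⟫ < 0}` through `z` with outer normal `ν`. [folklore] -/
def halfSpace (ν z : H) : Opens H :=
  ⟨{y | ⟪y - z, ν⟫ < 0}, isOpen_lt (by fun_prop) continuous_const⟩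

/-- The open half-ball `B(z,R) ∩ {y | ⟪y - z, ν⟫ < 0}` (Evans, *PDE*, §6.3.2, `U ∩ B(0,r)` after
flattening, with flat boundary portion `B(z,R) ∩ {⟪y - z, ν⟫ = 0}`). [cite: Evans2010, §6.3.2] -/
def halfBall (ν z : H) (R : ℝ) : Opens H :=
  ⟨ball z R ∩ {y | ⟪y - z, ν⟫ < 0}, isOpen_ball.inter (halfSpace ν z).isOpen⟩

variable {ν z : H} {R ρ : ℝ}

/-- Membership in the half-space. [folklore] -/
theorem mem_halfSpace {y : H} : y ∈ (halfSpace ν z : Set H) ↔ ⟪y - z, ν⟫ < 0 := Iff.rfl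

/-- Membership in the half-ball. [folklore] -/
theorem mem_halfBall {y : H} : y ∈ (halfBall ν z R : Set H) ↔ dist y z < R ∧ ⟪y - z, ν⟫ < 0 := by
  simp only [halfBall, Opens.coe_mk, mem_inter_iff, mem_ball, mem_setOf_eq]

/-- The half-ball is the ball intersected with the half-space. [folklore] -/
theorem halfBall_coe : (halfBall ν z R : Set H) = ball z R ∩ (halfSpace ν z : Set H) := rfl

/-- The half-ball lies in the ball. [folklore] -/
theorem halfBall_subset_ball : (halfBall ν z R : Set H) ⊆ ball z R := inter_subset_left

/-- The half-ball lies in the half-space. [folklore] -/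
theorem halfBall_le_halfSpace : halfBall ν z R ≤ halfSpace ν z := fun _ hy => hy.2

/-- Half-balls are monotone in the radius. [folklore] -/
theorem halfBall_mono (h : ρ ≤ R) : halfBall ν z ρ ≤ halfBall ν z R :=
  fun _ hy => ⟨ball_subset_ball h hy.1, hy.2⟩

/-- A tangential translate (`⟪w, ν⟫ = 0`) preserves the half-space. [folklore] -/
theorem add_mem_halfSpace {w : H} (hw : ⟪w, ν⟫ = 0) {y : H} (hy : y ∈ (halfSpace ν z : Set H)) :
    y + w ∈ (halfSpace ν z : Set H) := by
  rw [mem_halfSpace] at hy ⊢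
  rwa [show y + w - z = (y - z) + w by abel, inner_add_left, hw, add_zero]

/-- A tangential translate of length `≤ R - ρ` maps the half-ball `U_ρ` into `U_R`. [folklore] -/
theorem add_mem_halfBall {w : H} (hw : ⟪w, ν⟫ = 0) (hρ : ρ + ‖w‖ ≤ R) {y : H}
    (hy : y ∈ (halfBall ν z ρ : Set H)) : y + w ∈ (halfBall ν z R : Set H) := by
  rw [mem_halfBall] at hy
  refine ⟨?_, add_mem_halfSpace hw hy.2⟩
  rw [mem_ball, dist_eq_norm] at *
  calc ‖y + w - z‖ = ‖(y - z) + w‖ := by abel_nf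
    _ ≤ ‖y - z‖ + ‖w‖ := norm_add_le _ _
    _ < ρ + ‖w‖ := by rw [← dist_eq_norm]; linarith [hy.1, dist_eq_norm y z]
    _ ≤ R := hρ

/-- Segments of tangential translates stay in the larger half-ball. [folklore] -/
theorem add_smul_mem_halfBall {v : H} (hv : ⟪v, ν⟫ = 0) {t : ℝ} (hρ : ρ + |t| * ‖v‖ ≤ R) {y : H}
    (hy : y ∈ (halfBall ν z ρ : Set H)) {s : ℝ} (hs : s ∈ Icc (0:ℝ) 1) :
    y + (s * t) • v ∈ (halfBall ν z R : Set H) := by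
  refine add_mem_halfBall (by rw [inner_smul_left, hv]; simp) ?_ hy
  rw [norm_smul, Real.norm_eq_abs, abs_mul, abs_of_nonneg hs.1]
  calc ρ + s * |t| * ‖v‖ ≤ ρ + 1 * |t| * ‖v‖ := by gcongr; exact hs.2
    _ = ρ + |t| * ‖v‖ := by ring
    _ ≤ R := hρ

/-- The half-space is convex. [folklore] -/
theorem convex_halfSpace' : Convex ℝ (halfSpace ν z : Set H) := by
  have e : (halfSpace ν z : Set H) = {y : H | ⟪y, ν⟫ < ⟪z, ν⟫} := by
    ext y
    rw [mem_halfSpace, mem_setOf_eq, inner_sub_left, sub_neg]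
  rw [e]
  exact convex_halfSpace_lt ⟨fun x y => inner_add_left x y ν, fun c x => real_inner_smul_left x ν c⟩ _

/-- The half-ball is convex. [folklore] -/
theorem convex_halfBall : Convex ℝ (halfBall ν z R : Set H) :=
  (convex_ball z R).inter convex_halfSpace'

/-- The half-ball is bounded. [folklore] -/
theorem isBounded_halfBall : Bornology.IsBounded (halfBall ν z R : Set H) :=
  isBounded_ball.subset halfBall_subset_ball

/-- The half-ball is a (bounded) Lipschitz domain, being convex. [folklore] -/
theorem isLipschitzDomain_halfBall : IsLipschitzDomain (halfBall ν z R) :=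
  isLipschitzDomain_of_convex convex_halfBall isBounded_halfBall

/-- The half-ball has finite measure. [folklore] -/
theorem measure_halfBall_lt_top [FiniteDimensional ℝ H] [MeasurableSpace H] (μ : Measure H)
    [IsFiniteMeasureOnCompacts μ] : μ (halfBall ν z R : Set H) < ⊤ :=
  isBounded_halfBall.measure_lt_top

end Geometry

/-! ### Discrete integration by parts for the inner-product pairing -/

section InnerIBP

variable {H : Type*} [NormedAddCommGroup H] [NormedSpace ℝ H] [MeasurableSpace H] [BorelSpace H]
variable {W : Type*} [NormedAddCommGroup W] [InnerProductSpace ℝ W]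

omit [NormedSpace ℝ H] in
/-- **Change of variables half** of the discrete integration by parts, inner-product pairing: for a
weight `k` supported in `A` with `A + w ⊆ S`, `A ⊆ T`, `∫_S ⟪g(y), k(y - w)⟫ = ∫_T ⟪g(y + w), k(y)⟫`
(Evans, *PDE*, §5.8.2, proof of Theorem 3). [cite: Evans2010, §5.8.2 proof of Theorem 3] -/
theorem setIntegral_inner_comp_sub_eq (μ : Measure H) [μ.IsAddRightInvariant] {S T A : Set H}
    {k g : H → W} {w : H} (hk : support k ⊆ A) (hAS : ∀ y ∈ A, y + w ∈ S) (hAT : A ⊆ T) :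
    ∫ y in S, ⟪g y, k (y - w)⟫ ∂μ = ∫ y in T, ⟪g (y + w), k y⟫ ∂μ := by
  have h1 : ∫ y in S, ⟪g y, k (y - w)⟫ ∂μ = ∫ y, ⟪g y, k (y - w)⟫ ∂μ := by
    refine setIntegral_eq_integral_of_forall_compl_eq_zero fun y hy => ?_
    have : k (y - w) = 0 := by
      by_contra hne
      have hyA : y - w ∈ A := hk (mem_support.2 hne)
      have := hAS _ hyA
      simp only [sub_add_cancel] at this
      exact hy this
    rw [this, inner_zero_right]
  have h2 : ∫ y in T, ⟪g (y + w), k y⟫ ∂μ = ∫ y, ⟪g (y + w), k y⟫ ∂μ := by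
    refine setIntegral_eq_integral_of_forall_compl_eq_zero fun y hy => ?_
    have : k y = 0 := by
      by_contra hne
      exact hy (hAT (hk (mem_support.2 hne)))
    rw [this, inner_zero_right]
  rw [h1, h2]
  have := integral_add_right_eq_self (μ := μ) (fun y => ⟪g y, k (y - w)⟫) w
  simp only [add_sub_cancel_right] at this
  exact this.symm

/-- **Discrete integration by parts, inner-product pairing** (Evans, *PDE*, §6.3.1, proof of
Theorem 1, (19)): for a weight `k` with `supp k ⊆ A ⊆ Ω` and `A + t v ⊆ Ω`,
`∫_Ω ⟪g, D^{-t}_v k⟫ = -∫_Ω ⟪D^t_v g, k⟫`. [cite: Evans2010, §6.3.1 proof of Theorem 1] -/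
theorem setIntegral_inner_diffQuot_neg_eq (μ : Measure H) [μ.IsAddRightInvariant] {Ω : Opens H}
    {A : Set H} {k g : H → W} {v : H} {t : ℝ} (hk : support k ⊆ A)
    (hA : A ⊆ (Ω : Set H)) (hAp : ∀ y ∈ A, y + t • v ∈ (Ω : Set H))
    (hint : IntegrableOn (fun y => ⟪g y, k y⟫) (Ω : Set H) μ)
    (hint' : IntegrableOn (fun y => ⟪g (y + t • v), k y⟫) (Ω : Set H) μ) :
    ∫ y in (Ω : Set H), ⟪g y, diffQuot v (-t) k y⟫ ∂μ =
      -∫ y in (Ω : Set H), ⟪diffQuot v t g y, k y⟫ ∂μ := by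
  have hshift : ∫ y in (Ω : Set H), ⟪g y, k (y - t • v)⟫ ∂μ =
      ∫ y in (Ω : Set H), ⟪g (y + t • v), k y⟫ ∂μ :=
    setIntegral_inner_comp_sub_eq μ hk hAp hA
  have e1 : ∀ y, ⟪g y, diffQuot v (-t) k y⟫ = (-t)⁻¹ * (⟪g y, k (y - t • v)⟫ - ⟪g y, k y⟫) :=
    fun y => by
      rw [diffQuot, show y + -t • v = y - t • v by rw [neg_smul, sub_eq_add_neg], inner_smul_right,
        inner_sub_right]
  have e2 : ∀ y, ⟪diffQuot v t g y, k y⟫ = t⁻¹ * (⟪g (y + t • v), k y⟫ - ⟪g y, k y⟫) := fun y => by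
    rw [diffQuot, real_inner_smul_left, inner_sub_left]
  simp_rw [e1, e2]
  have hint'' : IntegrableOn (fun y => ⟪g y, k (y - t • v)⟫) (Ω : Set H) μ := by
    have hsupp : support (fun y => ⟪g (y + t • v), k y⟫) ⊆ (Ω : Set H) := by
      intro y hy
      apply hA; apply hk
      rw [mem_support] at hy ⊢
      exact fun h0 => hy (by rw [h0, inner_zero_right])
    have hI : Integrable (fun y => ⟪g (y + t • v), k y⟫) μ :=
      (integrableOn_iff_integrable_of_support_subset hsupp).1 hint'
    have := hI.comp_sub_right (t • v)
    simp only [sub_add_cancel] at this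
    exact this.integrableOn
  rw [integral_const_mul, integral_const_mul, integral_sub hint'' hint, integral_sub hint' hint, hshift,
    inv_neg, neg_mul]

end InnerIBP

/-! ### Pairings of `L²`-convergent sequences with a fixed `L²` function -/

section Pairing

variable {α : Type*} [MeasurableSpace α] {μ : Measure α}
variable {E F G : Type*} [NormedAddCommGroup E] [NormedSpace ℝ E] [NormedAddCommGroup F]
  [NormedSpace ℝ F] [NormedAddCommGroup G] [NormedSpace ℝ G]

/-- If `fₙ → f₀` in `L²` and `g ∈ L²`, then `∫ B(fₙ, g) → ∫ B(f₀, g)` for a continuous bilinear `B`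
(Hölder). [folklore] -/
theorem tendsto_integral_bilin_of_tendsto_eLpNorm (B : E →L[ℝ] F →L[ℝ] G) {f : ℕ → α → E}
    {f₀ : α → E} {g : α → F} (hf : ∀ n, MemLp (f n) 2 μ) (hf₀ : MemLp f₀ 2 μ) (hg : MemLp g 2 μ)
    (hlim : Tendsto (fun n => eLpNorm (f₀ - f n) 2 μ) atTop (𝓝 0)) :
    Tendsto (fun n => ∫ x, B (f n x) (g x) ∂μ) atTop (𝓝 (∫ x, B (f₀ x) (g x) ∂μ)) := by
  have hint : ∀ {h : α → E}, MemLp h 2 μ → Integrable (fun x => B (h x) (g x)) μ := fun hh =>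
    memLp_one_iff_integrable.1 (B.memLp_of_bilin 1 hh hg)
  rw [tendsto_iff_norm_sub_tendsto_zero]
  have hbound : ∀ n, ‖∫ x, B (f n x) (g x) ∂μ - ∫ x, B (f₀ x) (g x) ∂μ‖ ≤
      ‖B‖ * ((eLpNorm (f₀ - f n) 2 μ).toReal * (eLpNorm g 2 μ).toReal) := fun n => by
    rw [← integral_sub (hint (hf n)) (hint hf₀)]
    have hprod : Integrable (fun x => ‖(f₀ - f n) x‖ * ‖g x‖) μ :=
      memLp_one_iff_integrable.1 (hg.norm.mul' (hf₀.sub (hf n)).norm)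
    calc ‖∫ x, (B (f n x) (g x) - B (f₀ x) (g x)) ∂μ‖
        ≤ ∫ x, ‖B (f n x) (g x) - B (f₀ x) (g x)‖ ∂μ := norm_integral_le_integral_norm _
      _ ≤ ∫ x, ‖B‖ * (‖(f₀ - f n) x‖ * ‖g x‖) ∂μ := by
          refine integral_mono_of_nonneg (Eventually.of_forall fun _ => norm_nonneg _)
            (hprod.const_mul _) (Eventually.of_forall fun x => ?_)
          have e : B (f n x) (g x) - B (f₀ x) (g x) = -(B ((f₀ - f n) x) (g x)) := by
            rw [Pi.sub_apply, map_sub, sub_apply]; abel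
          show ‖B (f n x) (g x) - B (f₀ x) (g x)‖ ≤ ‖B‖ * (‖(f₀ - f n) x‖ * ‖g x‖)
          rw [e, norm_neg]
          calc ‖B ((f₀ - f n) x) (g x)‖ ≤ ‖B‖ * ‖(f₀ - f n) x‖ * ‖g x‖ := B.le_opNorm₂ _ _
            _ = ‖B‖ * (‖(f₀ - f n) x‖ * ‖g x‖) := by ring
      _ = ‖B‖ * ∫ x, ‖(f₀ - f n) x‖ * ‖g x‖ ∂μ := integral_const_mul _ _
      _ ≤ ‖B‖ * ((eLpNorm (f₀ - f n) 2 μ).toReal * (eLpNorm g 2 μ).toReal) := by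
          gcongr
          have h := abs_integral_mul_le_L2 (hf₀.sub (hf n)).norm hg.norm
          rw [eLpNorm_norm, eLpNorm_norm] at h
          exact (le_abs_self _).trans h
  refine squeeze_zero (fun n => norm_nonneg _) hbound ?_
  have h0 : Tendsto (fun n => (eLpNorm (f₀ - f n) 2 μ).toReal) atTop (𝓝 0) := by
    have := (ENNReal.tendsto_toReal ENNReal.zero_ne_top).comp hlim
    rw [ENNReal.toReal_zero] at this
    exact this
  simpa using (h0.mul_const ((eLpNorm g 2 μ).toReal)).const_mul ‖B‖

end Pairing

/-! ### The weak formulation on a half-ball and its extension to `W^{1,2}` test functions -/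

section Weak

variable {H : Type*} [NormedAddCommGroup H] [InnerProductSpace ℝ H] [FiniteDimensional ℝ H]
  [MeasurableSpace H] [BorelSpace H]

/-- **Weak solutions of the Neumann problem on a half-ball** (Evans, *PDE*, §6.3.2, proof of
Theorem 4, after flattening; Taylor, *PDE I*, Ch. 5, (7.22)–(7.24)): `u ∈ L²(U_R)` with weak
gradient `∇u = gu ∈ L²(U_R; H)` (`Du = ⟪gu, ·⟫`), data `F ∈ L²(U_R)`, `G ∈ W^{1,2}(U_R; H)`, and

  `∫_{U_R} Dζ (A ∇u) dμ = ∫_{U_R} (F ζ + Dζ (G)) dμ`  for all `ζ ∈ C_c^∞(B(z,R))`,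

i.e. `∫ ⟪A∇u, ∇ζ⟫ = ∫ (F ζ + ⟪G, ∇ζ⟫)`; the test functions need not vanish on the flat part
`{⟪y - z, ν⟫ = 0}` of `∂U_R`, which is the weak form of the conormal (Neumann) boundary condition
`⟪A∇u - G, ν⟫ = 0` there. [cite: Evans2010, §6.3.2 Theorem 4 (proof)] -/
structure IsWeakNeumannHalfBall (μ : Measure H) (ν z : H) (R : ℝ) (A : H → H →L[ℝ] H)
    (F : H → ℝ) (G : H → H) (u : H → ℝ) (gu : H → H) : Prop where
  /-- `u ∈ L²(U_R)`. -/
  memLp : MemLp u 2 (μ.restrict (halfBall ν z R : Set H))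
  /-- `∇u ∈ L²(U_R; H)`. -/
  memLp_grad : MemLp gu 2 (μ.restrict (halfBall ν z R : Set H))
  /-- `⟪gu, ·⟫` is the weak derivative of `u` on `U_R`. -/
  hasWeakFDerivOn : HasWeakFDerivOn (halfBall ν z R) μ u (fun y => innerSL ℝ (gu y))
  /-- `F ∈ L²(U_R)`. -/
  memLp_source : MemLp F 2 (μ.restrict (halfBall ν z R : Set H))
  /-- `G ∈ W^{1,2}(U_R; H)`. -/
  memSobolev_flux : MemSobolevDomain 1 2 (halfBall ν z R) μ G
  /-- The weak formulation against `C_c^∞(B(z,R))`. -/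
  weak_eq : ∀ ζ : H → ℝ, ContDiff ℝ ∞ ζ → HasCompactSupport ζ → tsupport ζ ⊆ ball z R →
    ∫ y in (halfBall ν z R : Set H), fderiv ℝ ζ y (A y (gu y)) ∂μ =
      ∫ y in (halfBall ν z R : Set H), (F y * ζ y + fderiv ℝ ζ y (G y)) ∂μ

variable {μ : Measure H} {ν z : H} {R : ℝ} {A : H → H →L[ℝ] H} {F : H → ℝ} {G : H → H}
  {u : H → ℝ} {gu : H → H}

/-- Continuous coefficients bounded by `M` on `S` map `L²(S; H)` to `L²(S; H)`, with
`‖A g‖_{L²(S)} ≤ M ‖g‖_{L²(S)}`. [folklore] -/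
theorem memLp_coeff_apply {S : Set H} (hSm : MeasurableSet S) {A : H → H →L[ℝ] H}
    (hA : Continuous A) {M : ℝ} (hM0 : 0 ≤ M) (hM : ∀ y ∈ S, ‖A y‖ ≤ M) {g : H → H}
    (hg : MemLp g 2 (μ.restrict S)) :
    MemLp (fun y => A y (g y)) 2 (μ.restrict S) ∧
      (eLpNorm (fun y => A y (g y)) 2 (μ.restrict S)).toReal ≤
        M * (eLpNorm g 2 (μ.restrict S)).toReal := by
  have hle : ∀ᵐ y ∂(μ.restrict S), ‖A y (g y)‖ ≤ M * ‖g y‖ := by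
    rw [ae_restrict_iff' hSm]
    refine Eventually.of_forall fun y hy => ?_
    calc ‖A y (g y)‖ ≤ ‖A y‖ * ‖g y‖ := (A y).le_opNorm _
      _ ≤ M * ‖g y‖ := by gcongr; exact hM y hy
  refine ⟨hg.of_le_mul (c := M) ?_ hle, toReal_eLpNorm_le_mul_of_ae_le hg hM0 hle⟩
  exact (ContinuousLinearMap.id ℝ (H →L[ℝ] H)).aestronglyMeasurable_comp₂
    hA.aestronglyMeasurable hg.1

omit [MeasurableSpace H] [BorelSpace H] in
/-- `‖A‖` is bounded on `B̄(z, ρ)` for continuous coefficients. [folklore] -/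
theorem exists_bound_coeff {V : Type*} [NormedAddCommGroup V] {A : H → V} (hA : Continuous A)
    (z : H) (ρ : ℝ) : ∃ M : ℝ, 0 ≤ M ∧ ∀ y ∈ closedBall z ρ, ‖A y‖ ≤ M := by
  obtain ⟨M, hM⟩ := (isCompact_closedBall z ρ).exists_bound_of_continuousOn hA.continuousOn
  exact ⟨max M 0, le_max_right _ _, fun y hy => (hM y hy).trans (le_max_left _ _)⟩

namespace IsWeakNeumannHalfBall

/-- **The weak formulation extends to `W^{1,2}(U_R)` test functions supported away from the round
part of the boundary** (Evans, *PDE*, §6.3.1, proof of Theorem 1, step 1: "by approximation … valid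
for `v ∈ H¹₀(U)`"; here, with the Neumann condition, for `ξ ∈ W^{1,2}(U_R)` vanishing together with
its weak derivative on `U_R ∖ B(z, ρ₁)`, `ρ₁ < R`): approximate `ξ` in `W^{1,2}(U_R)` by functions
smooth up to the boundary (`smooth_upToBoundary_dense_holds`, the half-ball being convex hence
Lipschitz), multiply by a cut-off `χ ∈ C_c^∞(B(z,R))` equal to `1` on `B(z, ρ₁)`, and pass to the
limit in both sides (Hölder). [cite: Evans2010, §6.3.1 Theorem 1 (proof, step 1)] -/
theorem weak_eq_extend [μ.IsAddHaarMeasure] (hsol : IsWeakNeumannHalfBall μ ν z R A F G u gu)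
    (hA : Continuous A) {ξ : H → ℝ} {Dξ : H → H →L[ℝ] ℝ}
    (hξ : MemLp ξ 2 (μ.restrict (halfBall ν z R : Set H)))
    (hDξ : MemLp Dξ 2 (μ.restrict (halfBall ν z R : Set H)))
    (hw : HasWeakFDerivOn (halfBall ν z R) μ ξ Dξ) {ρ₁ : ℝ} (hρ₁ : 0 < ρ₁) (hρ₁R : ρ₁ < R)
    (h0 : ∀ y ∈ (halfBall ν z R : Set H), ρ₁ ≤ dist y z → ξ y = 0)
    (h0' : ∀ y ∈ (halfBall ν z R : Set H), ρ₁ ≤ dist y z → Dξ y = 0) :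
    ∫ y in (halfBall ν z R : Set H), Dξ y (A y (gu y)) ∂μ =
      ∫ y in (halfBall ν z R : Set H), (F y * ξ y + Dξ y (G y)) ∂μ := by
  set U : Opens H := halfBall ν z R with hU_def
  have hUm : MeasurableSet (U : Set H) := U.isOpen.measurableSet
  have hUball : (U : Set H) ⊆ closedBall z R := halfBall_subset_ball.trans ball_subset_closedBall
  set ν' : Measure H := μ.restrict (U : Set H) with hν'
  -- `W^{1,2}` membership and smooth approximants up to the boundary
  have hξW : MemSobolevDomain 1 2 U μ ξ := by
    refine ⟨hξ, Dξ, hw, fun v => ?_⟩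
    rw [memSobolevDomain_zero_iff]
    exact hDξ.of_le_mul (c := ‖v‖) (hDξ.1.apply_continuousLinearMap v)
      (Eventually.of_forall fun y => by rw [mul_comm]; exact (Dξ y).le_opNorm v)
  obtain ⟨φ, hφ, hlim⟩ := smooth_upToBoundary_dense_holds (F := ℝ) isLipschitzDomain_halfBall
    isBounded_halfBall (k := 1) (p := 2) (by norm_num) (by norm_num) μ hξW
  have hφ1 : ∀ n, ContDiff ℝ 1 (φ n) := fun n => (hφ n).of_le (by simp)
  have hφd : ∀ n, Differentiable ℝ (φ n) := fun n => (hφ1 n).differentiable one_ne_zero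
  -- the cut-off `χ = 1` on `B(z, ρ₁)`, supported in `B(z, R)`
  let χ : ContDiffBump z := ⟨ρ₁, (ρ₁ + R) / 2, hρ₁, by linarith⟩
  have hχR : χ.rOut < R := by show (ρ₁ + R) / 2 < R; linarith
  have hχs : tsupport (χ : H → ℝ) ⊆ ball z R := by
    rw [χ.tsupport_eq]; exact closedBall_subset_ball hχR
  have hχd : Differentiable ℝ (χ : H → ℝ) := (χ.contDiff (n := 1)).differentiable one_ne_zero
  have hχc : Continuous (χ : H → ℝ) := χ.continuous
  have hDχc : Continuous (fderiv ℝ (χ : H → ℝ)) := (χ.contDiff (n := 1)).continuous_fderiv one_ne_zero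
  obtain ⟨Cχ, hCχ⟩ : ∃ C, ∀ y, ‖fderiv ℝ (χ : H → ℝ) y‖ ≤ C :=
    (χ.hasCompactSupport.fderiv (𝕜 := ℝ)).exists_bound_of_continuous hDχc
  have hCχ0 : 0 ≤ Cχ := (norm_nonneg _).trans (hCχ z)
  have hχle : ∀ y, ‖(χ : H → ℝ) y‖ ≤ 1 := fun y => by
    rw [Real.norm_eq_abs, abs_of_nonneg χ.nonneg]; exact χ.le_one
  have hχ1 : ∀ y, dist y z < ρ₁ → (χ : H → ℝ) y = 1 := fun y hy =>
    χ.one_of_mem_closedBall (mem_closedBall.2 hy.le)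
  have hDχ0 : ∀ y, dist y z < ρ₁ → fderiv ℝ (χ : H → ℝ) y = 0 := fun y hy => by
    rw [(χ.eventuallyEq_one_of_mem_ball (mem_ball.2 hy)).fderiv_eq]
    exact fderiv_const_apply (1 : ℝ)
  -- the weak formulation for `ζₙ = χ φₙ`
  have hfd : ∀ n y, fderiv ℝ (fun y => χ y * φ n y) y = χ y • fderiv ℝ (φ n) y + φ n y • fderiv ℝ χ y :=
    fun n y => fderiv_mul (hχd y) (hφd n y)
  obtain ⟨Dn, hDn⟩ : ∃ Dn : ℕ → H → H →L[ℝ] ℝ,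
      ∀ n, Dn n = (fun y => χ y • fderiv ℝ (φ n) y) + fun y => φ n y • fderiv ℝ χ y :=
    ⟨_, fun n => rfl⟩
  obtain ⟨D₀, hD₀⟩ : ∃ D₀ : H → H →L[ℝ] ℝ,
      D₀ = (fun y => χ y • Dξ y) + fun y => ξ y • fderiv ℝ χ y := ⟨_, rfl⟩
  have hweak : ∀ n, ∫ y in (U : Set H), Dn n y (A y (gu y)) ∂μ =
      ∫ y in (U : Set H), (F y * (χ y * φ n y) + Dn n y (G y)) ∂μ := fun n => by
    have h := hsol.weak_eq (fun y => χ y * φ n y) (χ.contDiff.mul (hφ n))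
      χ.hasCompactSupport.mul_right ((tsupport_mul_subset_left).trans hχs)
    simp only [hfd] at h
    simp only [hDn, Pi.add_apply]
    exact h
  -- `L²` data
  have hgu : MemLp gu 2 ν' := hsol.memLp_grad
  obtain ⟨M, hM0, hM⟩ := exists_bound_coeff hA z R
  have ha : MemLp (fun y => A y (gu y)) 2 ν' :=
    (memLp_coeff_apply hUm hA hM0 (fun y hy => hM y (hUball hy)) hgu).1
  have hGm : MemLp G 2 ν' := hsol.memSobolev_flux.memLp
  have hFm : MemLp F 2 ν' := hsol.memLp_source
  have hb : Bornology.IsBounded (U : Set H) := isBounded_halfBall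
  have hDnm : ∀ n, MemLp (Dn n) 2 ν' := fun n => by
    rw [hDn]
    exact MemLp.add (ε := H →L[ℝ] ℝ) (memLp_restrict_of_continuous_of_isBounded
      (hχc.smul ((hφ1 n).continuous_fderiv one_ne_zero)) hb)
      (memLp_restrict_of_continuous_of_isBounded ((hφ n).continuous.smul hDχc) hb)
  have hφm : ∀ n, MemLp (φ n) 2 ν' := fun n =>
    memLp_restrict_of_continuous_of_isBounded (hφ n).continuous hb
  have hχφm : ∀ n, MemLp (fun y => χ y * φ n y) 2 ν' := fun n =>
    memLp_restrict_of_continuous_of_isBounded (hχc.mul (hφ n).continuous) hb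
  have hχξm : MemLp (fun y => χ y * ξ y) 2 ν' :=
    hξ.of_le_mul (c := 1) ((hχc.aestronglyMeasurable).mul hξ.1)
      (Eventually.of_forall fun y => by
        rw [norm_mul, one_mul]; exact mul_le_of_le_one_left (norm_nonneg _) (hχle y))
  have hD₀m : MemLp D₀ 2 ν' := by
    have h1 : MemLp (fun y => χ y • Dξ y) 2 ν' :=
      hDξ.of_le_mul (c := 1) (hχc.aestronglyMeasurable.smul hDξ.1)
        (Eventually.of_forall fun y => by
          rw [norm_smul, one_mul]; exact mul_le_of_le_one_left (norm_nonneg _) (hχle y))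
    have h2 : MemLp (fun y => ξ y • fderiv ℝ χ y) 2 ν' :=
      hξ.of_le_mul (c := Cχ) (hξ.1.smul hDχc.aestronglyMeasurable)
        (Eventually.of_forall fun y => by
          rw [norm_smul, mul_comm]; exact mul_le_mul_of_nonneg_right (hCχ y) (norm_nonneg _))
    rw [hD₀]
    exact MemLp.add (ε := H →L[ℝ] ℝ) h1 h2
  -- `L²` convergences: `φₙ → ξ`, `Dφₙ → Dξ`, hence `χ φₙ → χ ξ` and `Dn → D₀`
  have hL : Tendsto (fun n => eLpNorm (ξ - φ n) 2 ν') atTop (𝓝 0) :=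
    tendsto_of_tendsto_of_tendsto_of_le_of_le tendsto_const_nhds hlim (fun _ => bot_le)
      fun _ => eLpNorm_le_eSobolevDomainNorm
  have hDL : Tendsto (fun n => eLpNorm (fun y => Dξ y - fderiv ℝ (φ n) y) 2 ν') atTop (𝓝 0) :=
    tendsto_eLpNorm_fderiv_of_tendsto_eSobolevDomainNorm_of_contDiff (by norm_num) hw hφ1 hlim
  have hlim1 : Tendsto (fun n => eLpNorm ((fun y => χ y * ξ y) - fun y => χ y * φ n y) 2 ν') atTop
      (𝓝 0) := by
    refine tendsto_of_tendsto_of_tendsto_of_le_of_le tendsto_const_nhds hL (fun _ => bot_le)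
      fun n => ?_
    refine eLpNorm_mono fun y => ?_
    rw [Pi.sub_apply, Pi.sub_apply, ← mul_sub, norm_mul]
    exact mul_le_of_le_one_left (norm_nonneg _) (hχle y)
  have hlim2 : Tendsto (fun n => eLpNorm (D₀ - Dn n) 2 ν') atTop (𝓝 0) := by
    have hsplit : ∀ n, eLpNorm (D₀ - Dn n) 2 ν' ≤
        eLpNorm (fun y => Dξ y - fderiv ℝ (φ n) y) 2 ν' +
          ENNReal.ofReal Cχ * eLpNorm (ξ - φ n) 2 ν' := fun n => by
      have e : D₀ - Dn n = (fun y => χ y • (Dξ y - fderiv ℝ (φ n) y)) +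
          fun y => (ξ - φ n) y • fderiv ℝ χ y := by
        rw [hD₀, hDn]
        funext y
        simp only [Pi.sub_apply, Pi.add_apply]
        rw [smul_sub, sub_smul]
        abel
      rw [e]
      refine (eLpNorm_add_le (ε := H →L[ℝ] ℝ) ?_ ?_ (by norm_num)).trans (add_le_add ?_ ?_)
      · exact hχc.aestronglyMeasurable.smul (hDξ.1.sub
          (((hφ1 n).continuous_fderiv one_ne_zero).aestronglyMeasurable))
      · exact (hξ.1.sub (hφm n).1).smul hDχc.aestronglyMeasurable
      · refine eLpNorm_mono fun y => ?_
        rw [norm_smul]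
        exact mul_le_of_le_one_left (norm_nonneg _) (hχle y)
      · refine eLpNorm_le_mul_eLpNorm_of_ae_le_mul (Eventually.of_forall fun y => ?_) 2
        rw [norm_smul, mul_comm]
        exact mul_le_mul_of_nonneg_right (hCχ y) (norm_nonneg _)
    have hsum : Tendsto (fun n => eLpNorm (fun y => Dξ y - fderiv ℝ (φ n) y) 2 ν' +
        ENNReal.ofReal Cχ * eLpNorm (ξ - φ n) 2 ν') atTop (𝓝 0) := by
      have := hDL.add (ENNReal.Tendsto.const_mul (a := ENNReal.ofReal Cχ) hL
        (Or.inr ENNReal.ofReal_ne_top))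
      simpa using this
    exact tendsto_of_tendsto_of_tendsto_of_le_of_le tendsto_const_nhds hsum (fun _ => bot_le) hsplit
  -- pass to the limit in both sides
  set Bap : (H →L[ℝ] ℝ) →L[ℝ] H →L[ℝ] ℝ := ContinuousLinearMap.id ℝ (H →L[ℝ] ℝ) with hBap
  have hLHS : Tendsto (fun n => ∫ y in (U : Set H), Dn n y (A y (gu y)) ∂μ) atTop
      (𝓝 (∫ y in (U : Set H), D₀ y (A y (gu y)) ∂μ)) :=
    tendsto_integral_bilin_of_tendsto_eLpNorm Bap hDnm hD₀m ha hlim2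
  have hRHS2 : Tendsto (fun n => ∫ y in (U : Set H), Dn n y (G y) ∂μ) atTop
      (𝓝 (∫ y in (U : Set H), D₀ y (G y) ∂μ)) :=
    tendsto_integral_bilin_of_tendsto_eLpNorm Bap hDnm hD₀m hGm hlim2
  have hRHS1 : Tendsto (fun n => ∫ y in (U : Set H), F y * (χ y * φ n y) ∂μ) atTop
      (𝓝 (∫ y in (U : Set H), F y * (χ y * ξ y) ∂μ)) := by
    have h := tendsto_integral_bilin_of_tendsto_eLpNorm (ContinuousLinearMap.mul ℝ ℝ) hχφm hχξm
      hFm hlim1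
    simp only [ContinuousLinearMap.mul_apply'] at h
    simp_rw [mul_comm (F _)]
    exact h
  have hint1 : ∀ n, Integrable (fun y => F y * (χ y * φ n y)) ν' := fun n =>
    memLp_one_iff_integrable.1 ((hχφm n).mul' hFm)
  have hint2 : ∀ n, Integrable (fun y => Dn n y (G y)) ν' := fun n =>
    memLp_one_iff_integrable.1 (Bap.memLp_of_bilin 1 (hDnm n) hGm)
  have hRHS : Tendsto (fun n => ∫ y in (U : Set H), (F y * (χ y * φ n y) + Dn n y (G y)) ∂μ) atTop
      (𝓝 (∫ y in (U : Set H), F y * (χ y * ξ y) ∂μ + ∫ y in (U : Set H), D₀ y (G y) ∂μ)) := by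
    have e : ∀ n, ∫ y in (U : Set H), (F y * (χ y * φ n y) + Dn n y (G y)) ∂μ =
        ∫ y in (U : Set H), F y * (χ y * φ n y) ∂μ + ∫ y in (U : Set H), Dn n y (G y) ∂μ :=
      fun n => integral_add (hint1 n) (hint2 n)
    simp_rw [e]
    exact hRHS1.add hRHS2
  have heq : ∫ y in (U : Set H), D₀ y (A y (gu y)) ∂μ =
      ∫ y in (U : Set H), F y * (χ y * ξ y) ∂μ + ∫ y in (U : Set H), D₀ y (G y) ∂μ :=
    tendsto_nhds_unique hLHS (by simp_rw [hweak]; exact hRHS)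
  -- on `U`, `D₀ = Dξ` and `χ ξ = ξ`
  have hD₀U : ∀ y ∈ (U : Set H), D₀ y = Dξ y := fun y hy => by
    rw [hD₀, Pi.add_apply]
    by_cases hd : dist y z < ρ₁
    · simp only [hχ1 y hd, hDχ0 y hd, one_smul, smul_zero, add_zero]
    · simp only [h0 y hy (not_lt.1 hd), h0' y hy (not_lt.1 hd), smul_zero, zero_smul, add_zero]
  have hχξU : ∀ y ∈ (U : Set H), χ y * ξ y = ξ y := fun y hy => by
    by_cases hd : dist y z < ρ₁
    · rw [hχ1 y hd, one_mul]
    · rw [h0 y hy (not_lt.1 hd), mul_zero]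
  have hintF : Integrable (fun y => F y * ξ y) ν' := memLp_one_iff_integrable.1 (hξ.mul' hFm)
  have hintD : Integrable (fun y => Dξ y (G y)) ν' :=
    memLp_one_iff_integrable.1 (Bap.memLp_of_bilin 1 hDξ hGm)
  rw [setIntegral_congr_fun hUm (fun y hy => by rw [hD₀U y hy]),
    setIntegral_congr_fun hUm (fun y hy => show F y * (χ y * ξ y) = F y * ξ y by rw [hχξU y hy]),
    setIntegral_congr_fun hUm (fun y hy => show D₀ y (G y) = Dξ y (G y) by rw [hD₀U y hy]),
    ← integral_add hintF hintD] at heq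
  exact heq

end IsWeakNeumannHalfBall

end Weak

/-! ### Generic `L²` facts for difference quotients and zero extensions -/

section Toolkit

variable {H : Type*} [NormedAddCommGroup H] [InnerProductSpace ℝ H] [FiniteDimensional ℝ H]
  [MeasurableSpace H] [BorelSpace H]
variable {W : Type*} [NormedAddCommGroup W] [NormedSpace ℝ W]

omit [FiniteDimensional ℝ H] in
/-- A difference quotient of an `L²(Ω)` function is in `L²(Ω')` when `Ω' + t v ⊆ Ω`, `Ω' ⊆ Ω`
(`‖D^t f‖ ≤ 2|t|⁻¹ ‖f‖`). [folklore] -/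
theorem memLp_diffQuot (μ : Measure H) [μ.IsAddHaarMeasure] {Ω Ω' : Opens H} {f : H → W}
    (hf : MemLp f 2 (μ.restrict (Ω : Set H))) (hle : Ω' ≤ Ω) {v : H} {t : ℝ}
    (hΩ : ∀ y ∈ (Ω' : Set H), y + t • v ∈ (Ω : Set H)) :
    MemLp (diffQuot v t f) 2 (μ.restrict (Ω' : Set H)) := by
  have e : diffQuot v t f = t⁻¹ • ((fun y => f (y + t • v)) - f) := by
    funext y; simp [diffQuot]
  rw [e]
  exact ((memLp_comp_add μ hf hΩ).sub (hf.mono_measure (Measure.restrict_mono_set μ hle))).const_smul _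

end Toolkit

/-! ### The test function of Nirenberg's argument and its zero extension to the half-space -/

section TestFunctionDefs

variable {H : Type*}

/-- The cut-off test function `η² w`, extended by zero off `S` (Evans, *PDE*, §6.3.2, proof of
Theorem 4, `v = -D^{-h}_k(ζ² D^h_k u)` before the outer difference quotient). [cite: Evans2010, §6.3.2 Theorem 4 (proof)] -/
def cutoffTest (S : Set H) (η w : H → ℝ) : H → ℝ :=
  S.indicator fun y => η y * η y * w y

/-- Support of the cut-off test function: inside `S ∩ supp η`. [folklore] -/
theorem support_cutoffTest_subset (S : Set H) (η w : H → ℝ) :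
    support (cutoffTest S η w) ⊆ S ∩ support η := by
  intro y hy
  rw [mem_support, cutoffTest] at hy
  by_cases hyS : y ∈ S
  · rw [indicator_of_mem hyS] at hy
    exact ⟨hyS, fun h0 => hy (by rw [h0, zero_mul, zero_mul])⟩
  · exact absurd (indicator_of_notMem hyS _) hy

variable [NormedAddCommGroup H] [InnerProductSpace ℝ H] [CompleteSpace H]

/-- The (weak) gradient `η² ∇w + 2 η w ∇η` of `cutoffTest S η w`, extended by zero off `S`.
[cite: Evans2010, §6.3.2 Theorem 4 (proof)] -/
def cutoffTestGrad (S : Set H) (η w : H → ℝ) (gw : H → H) : H → H :=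
  S.indicator fun y => (η y * η y) • gw y + (2 * η y * w y) • gradient η y

/-- `⟪∇η(y), h⟫ = Dη(y) h`. [folklore] -/
theorem inner_gradient_left (η : H → ℝ) (y h : H) : ⟪gradient η y, h⟫ = fderiv ℝ η y h := by
  rw [gradient, InnerProductSpace.toDual_symm_apply]

/-- `‖∇η(y)‖ = ‖Dη(y)‖`. [folklore] -/
theorem norm_gradient_eq (η : H → ℝ) (y : H) : ‖gradient η y‖ = ‖fderiv ℝ η y‖ := by
  rw [gradient, LinearIsometryEquiv.norm_map]

/-- Support of the gradient of the cut-off test function: inside `S ∩ supp η`. [folklore] -/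
theorem support_cutoffTestGrad_subset (S : Set H) (η w : H → ℝ) (gw : H → H) :
    support (cutoffTestGrad S η w gw) ⊆ S ∩ support η := by
  intro y hy
  rw [mem_support, cutoffTestGrad] at hy
  by_cases hyS : y ∈ S
  · rw [indicator_of_mem hyS] at hy
    refine ⟨hyS, fun h0 => hy ?_⟩
    rw [h0, mul_zero, zero_smul, mul_zero, zero_mul, zero_smul, add_zero]
  · exact absurd (indicator_of_notMem hyS _) hy

end TestFunctionDefs

section TestFunction

variable {H : Type*} [NormedAddCommGroup H] [InnerProductSpace ℝ H] [FiniteDimensional ℝ H]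
  [MeasurableSpace H] [BorelSpace H]
variable {μ : Measure H} {ν z : H} {ρ : ℝ} {w : H → ℝ} {gw : H → H}

/-- **The zero extension of `η² w` is weakly differentiable on the half-space** with gradient
`cutoffTestGrad`, provided `supp η ∩ {half-space} ⊆ U_ρ` (Leibniz rule and extension by zero,
`hasWeakFDerivOn_indicator_smul`). [folklore] -/
theorem hasWeakFDerivOn_cutoffTest [IsFiniteMeasureOnCompacts μ]
    (hw : HasWeakFDerivOn (halfBall ν z ρ) μ w (fun y => innerSL ℝ (gw y)))
    (hwm : MemLp w 2 (μ.restrict (halfBall ν z ρ : Set H)))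
    (hgwm : MemLp gw 2 (μ.restrict (halfBall ν z ρ : Set H))) {η : H → ℝ} (hη : ContDiff ℝ ∞ η)
    (hηs : tsupport η ∩ (halfSpace ν z : Set H) ⊆ (halfBall ν z ρ : Set H)) :
    HasWeakFDerivOn (halfSpace ν z) μ (cutoffTest (halfBall ν z ρ : Set H) η w)
      (fun y => innerSL ℝ (cutoffTestGrad (halfBall ν z ρ : Set H) η w gw y)) := by
  set S : Set H := (halfBall ν z ρ : Set H) with hS_def
  have hSm : MeasurableSet S := (halfBall ν z ρ).isOpen.measurableSet
  haveI : IsFiniteMeasure (μ.restrict S) := ⟨by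
    rw [Measure.restrict_apply_univ]; exact measure_halfBall_lt_top μ⟩
  -- global local integrability of the zero extensions
  have hfi : LocallyIntegrable (S.indicator w) μ :=
    locallyIntegrable_indicator_of_memLp (by norm_num : (1 : ℝ≥0∞) ≤ 2) hwm
  have hgwm' : MemLp (fun y => innerSL ℝ (gw y)) 2 (μ.restrict S) :=
    hgwm.of_le_mul (c := 1) ((innerSL ℝ).continuous.comp_aestronglyMeasurable hgwm.1)
      (Eventually.of_forall fun y => by rw [innerSL_apply_norm, one_mul])
  have hgi : LocallyIntegrable (S.indicator fun y => innerSL ℝ (gw y)) μ :=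
    locallyIntegrable_indicator_of_memLp (by norm_num : (1 : ℝ≥0∞) ≤ 2) hgwm'
  have hη2 : ContDiff ℝ ∞ fun y => η y * η y := hη.mul hη
  have hη2s : tsupport (fun y => η y * η y) ∩ (halfSpace ν z : Set H) ⊆ S :=
    (inter_subset_inter_left _ (tsupport_mul_subset_left (f := η) (g := η))).trans hηs
  have h := hasWeakFDerivOn_indicator_smul (Ω' := halfSpace ν z) hw hfi hgi hη2 hη2s
  have hηd : Differentiable ℝ η := hη.differentiable (by simp)
  refine hasWeakFDerivOn_congr h (fun y _ => ?_) (fun y _ => ?_)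
  · simp only [cutoffTest, smul_eq_mul, hS_def]
  · by_cases hyS : y ∈ S
    · rw [cutoffTestGrad, indicator_of_mem hyS, indicator_of_mem hyS]
      ext h'
      rw [innerSL_apply_apply, add_apply, smul_apply,
        ContinuousLinearMap.smulRight_apply, innerSL_apply_apply, fderiv_fun_mul (hηd y) (hηd y),
        inner_add_left, real_inner_smul_left, real_inner_smul_left, inner_gradient_left]
      simp only [add_apply, smul_apply, smul_eq_mul]
      ring
    · rw [cutoffTestGrad, indicator_of_notMem hyS, indicator_of_notMem hyS, map_zero]

omit [FiniteDimensional ℝ H] in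
/-- `η² w ∈ L²` of the half-space (zero extension). [folklore] -/
theorem memLp_cutoffTest (hwm : MemLp w 2 (μ.restrict (halfBall ν z ρ : Set H))) {η : H → ℝ}
    (hηc : Continuous η) (hη1 : ∀ y, |η y| ≤ 1) :
    MemLp (cutoffTest (halfBall ν z ρ : Set H) η w) 2 (μ.restrict (halfSpace ν z : Set H)) := by
  have hSm : MeasurableSet (halfBall ν z ρ : Set H) := (halfBall ν z ρ).isOpen.measurableSet
  refine ((memLp_indicator_iff_restrict hSm).2 ?_).mono_measure Measure.restrict_le_self
  refine hwm.of_le_mul (c := 1) ((hηc.mul hηc).aestronglyMeasurable.mul hwm.1)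
    (Eventually.of_forall fun y => ?_)
  rw [norm_mul, norm_mul, Real.norm_eq_abs, one_mul]
  exact mul_le_of_le_one_left (norm_nonneg _) (mul_le_one₀ (hη1 y) (abs_nonneg _) (hη1 y))

/-- `η² ∇w + 2ηw ∇η ∈ L²` of the half-space (zero extension), with the bound
`‖·‖_{L²} ≤ ‖η ∇w‖_{L²(U_ρ)} + 2 C_η ‖w‖_{L²(U_ρ)}` recorded separately below. [folklore] -/
theorem memLp_cutoffTestGrad (hwm : MemLp w 2 (μ.restrict (halfBall ν z ρ : Set H)))
    (hgwm : MemLp gw 2 (μ.restrict (halfBall ν z ρ : Set H))) {η : H → ℝ} (hη : ContDiff ℝ 1 η)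
    (hη1 : ∀ y, |η y| ≤ 1) {C : ℝ} (hC : ∀ y, ‖fderiv ℝ η y‖ ≤ C) :
    MemLp (cutoffTestGrad (halfBall ν z ρ : Set H) η w gw) 2
      (μ.restrict (halfSpace ν z : Set H)) := by
  have hSm : MeasurableSet (halfBall ν z ρ : Set H) := (halfBall ν z ρ).isOpen.measurableSet
  have hηc : Continuous η := hη.continuous
  have hgc : Continuous (gradient η) :=
    (InnerProductSpace.toDual ℝ H).symm.continuous.comp (hη.continuous_fderiv one_ne_zero)
  refine ((memLp_indicator_iff_restrict hSm).2 ?_).mono_measure Measure.restrict_le_self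
  refine MemLp.add ?_ ?_
  · refine hgwm.of_le_mul (c := 1) ((hηc.mul hηc).aestronglyMeasurable.smul hgwm.1)
      (Eventually.of_forall fun y => ?_)
    rw [norm_smul, norm_mul, Real.norm_eq_abs, one_mul]
    exact mul_le_of_le_one_left (norm_nonneg _) (mul_le_one₀ (hη1 y) (abs_nonneg _) (hη1 y))
  · refine hwm.of_le_mul (c := 2 * C)
      (((continuous_const.mul hηc).aestronglyMeasurable.mul hwm.1).smul hgc.aestronglyMeasurable)
      (Eventually.of_forall fun y => ?_)
    rw [norm_smul, norm_mul, norm_mul, Real.norm_ofNat, Real.norm_eq_abs, norm_gradient_eq]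
    have hC0 : 0 ≤ C := (norm_nonneg _).trans (hC y)
    calc 2 * |η y| * ‖w y‖ * ‖fderiv ℝ η y‖ ≤ 2 * 1 * ‖w y‖ * C := by
          gcongr
          · exact hη1 y
          · exact hC y
      _ = 2 * C * ‖w y‖ := by ring

end TestFunction

/-! ### Pointwise tools for the energy estimate -/

section Pointwise

variable {H : Type*} [NormedAddCommGroup H] [InnerProductSpace ℝ H]

/-- **Discrete Leibniz rule** `D^t (A g) = A(· + t v) D^t g + (D^t A) g`. [folklore] -/
theorem diffQuot_coeff_apply (A : H → H →L[ℝ] H) (g : H → H) (v : H) (t : ℝ) (y : H) :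
    diffQuot v t (fun y => A y (g y)) y =
      A (y + t • v) (diffQuot v t g y) + diffQuot v t A y (g y) := by
  simp only [diffQuot, map_smul, map_sub, FunLike.coe_smul, FunLike.coe_sub,
    Pi.smul_apply, Pi.sub_apply, smul_sub]
  abel

/-- Expansion of `⟪A₁ gw + D gu, η(η gw) + (2ηw) g⟫` used in the energy estimate. [folklore] -/
theorem inner_energy_expand (A₁ D : H →L[ℝ] H) (gw gu g : H) (η w : ℝ) :
    ⟪A₁ gw + D gu, η • (η • gw) + (2 * η * w) • g⟫ =
      ⟪A₁ (η • gw), η • gw⟫ + 2 * ⟪A₁ (η • gw), w • g⟫ + ⟪D (η • gu), η • gw⟫ +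
        2 * ⟪D (η • gu), w • g⟫ := by
  simp only [map_smul, inner_add_left, inner_add_right, real_inner_smul_left,
    real_inner_smul_right]
  ring

/-- **Mean value bound for difference quotients**: on a convex set `s` containing `y` and
`y + t v` (`‖v‖ = 1`), `‖D^t_v A (y)‖ ≤ sup_s ‖DA‖`. [folklore] -/
theorem norm_diffQuot_le_of_norm_fderiv_le {V : Type*} [NormedAddCommGroup V] [NormedSpace ℝ V]
    {A : H → V} {s : Set H} (hs : Convex ℝ s) (hA : ∀ x ∈ s, DifferentiableAt ℝ A x) {M : ℝ}
    (hM : ∀ x ∈ s, ‖fderiv ℝ A x‖ ≤ M) {v : H} (hv1 : ‖v‖ = 1) {t : ℝ} {y : H} (hy : y ∈ s)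
    (hyt : y + t • v ∈ s) : ‖diffQuot v t A y‖ ≤ M := by
  have hM0 : 0 ≤ M := (norm_nonneg _).trans (hM y hy)
  by_cases ht : t = 0
  · simp only [diffQuot, ht, inv_zero, zero_smul, norm_zero]; exact hM0
  have h := hs.norm_image_sub_le_of_norm_fderiv_le hA hM hy hyt
  rw [add_sub_cancel_left, norm_smul, Real.norm_eq_abs, hv1, mul_one] at h
  rw [diffQuot, norm_smul, norm_inv, Real.norm_eq_abs]
  calc |t|⁻¹ * ‖A (y + t • v) - A y‖ ≤ |t|⁻¹ * (M * |t|) := by gcongr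
    _ = M := by field_simp

/-- A difference quotient of a function supported in `B(z, ρ)` vanishes at points at distance
`≥ ρ + ‖t v‖` from `z`. [folklore] -/
theorem diffQuot_eq_zero_of_support_subset {V : Type*} [NormedAddCommGroup V] [NormedSpace ℝ V]
    {k : H → V} {z : H} {ρ : ℝ} (hk : support k ⊆ ball z ρ) {v : H} {t : ℝ} {y : H}
    (hy : ρ + ‖t • v‖ ≤ dist y z) : diffQuot v t k y = 0 := by
  have h0 : ∀ x, ρ ≤ dist x z → k x = 0 := fun x hx => by
    by_contra hne
    have := hk (mem_support.2 hne)
    rw [mem_ball] at this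
    linarith
  have h1 : k y = 0 := h0 y (by linarith [norm_nonneg (t • v)])
  have h2 : k (y + t • v) = 0 := h0 _ (by
    have := dist_triangle y (y + t • v) z
    rw [dist_eq_norm y (y + t • v), show y - (y + t • v) = -(t • v) by abel, norm_neg] at this
    linarith)
  simp only [diffQuot, h1, h2, sub_zero, smul_zero]

/-- `λ X² ≤ α X + β` with `λ > 0`, `α, β ≥ 0` forces `X ≤ α/λ + √(β/λ)`. [folklore] -/
theorem le_of_sq_le_affine {lam X α β : ℝ} (hlam : 0 < lam) (hα : 0 ≤ α) (hβ : 0 ≤ β)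
    (h : lam * X ^ 2 ≤ α * X + β) : X ≤ α / lam + Real.sqrt (β / lam) := by
  set a := α / lam with ha
  set b := β / lam with hb
  have ha0 : 0 ≤ a := div_nonneg hα hlam.le
  have hb0 : 0 ≤ b := div_nonneg hβ hlam.le
  have h' : X ^ 2 ≤ a * X + b := by
    rw [ha, hb, div_mul_eq_mul_div, ← add_div, le_div_iff₀ hlam]
    linarith
  by_contra hlt'
  have hlt := not_le.1 hlt'
  have hs0 : 0 ≤ Real.sqrt b := Real.sqrt_nonneg b
  have hsq : Real.sqrt b * Real.sqrt b = b := Real.mul_self_sqrt hb0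
  have h1 : b ≤ Real.sqrt b * X := by nlinarith
  have h2 : a * X + b < X ^ 2 := by nlinarith
  linarith

end Pointwise

/-! ### The energy estimate (Evans §6.3.2, Theorem 4, steps 2–3) -/

section Energy

variable {H : Type*} [NormedAddCommGroup H] [InnerProductSpace ℝ H] [FiniteDimensional ℝ H]
  [MeasurableSpace H] [BorelSpace H]
variable {μ : Measure H} {ν z : H} {R : ℝ} {A : H → H →L[ℝ] H} {F : H → ℝ} {G : H → H}
  {u : H → ℝ} {gu : H → H}

omit [FiniteDimensional ℝ H] [BorelSpace H] in
/-- `innerSL ∘ g ∈ L²` for `g ∈ L²`. [folklore] -/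
theorem memLp_innerSL_comp {μ' : Measure H} {g : H → H} (hg : MemLp g 2 μ') :
    MemLp (fun y => innerSL ℝ (g y)) 2 μ' :=
  hg.of_le_mul (c := 1) ((innerSL ℝ).continuous.comp_aestronglyMeasurable hg.1)
    (Eventually.of_forall fun y => by rw [innerSL_apply_norm, one_mul])

omit [FiniteDimensional ℝ H] [BorelSpace H] in
/-- A component `⟪g, v⟫` of an `L²` field is in `L²`, with norm `≤ ‖v‖ ‖g‖`. [folklore] -/
theorem memLp_inner_const {μ' : Measure H} {g : H → H} (hg : MemLp g 2 μ') (v : H) :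
    MemLp (fun y => ⟪g y, v⟫) 2 μ' :=
  hg.of_le_mul (c := ‖v‖) (hg.1.inner aestronglyMeasurable_const)
    (Eventually.of_forall fun y => by rw [mul_comm]; exact norm_inner_le_norm (g y) v)

/-- Difference quotients of a weakly differentiable function (gradient form). [folklore] -/
theorem hasWeakFDerivOn_diffQuot_innerSL (μ : Measure H) [μ.IsAddHaarMeasure] {Ω Ω' : Opens H}
    {f : H → ℝ} {g : H → H} (h : HasWeakFDerivOn Ω μ f (fun y => innerSL ℝ (g y))) (hle : Ω' ≤ Ω)
    {v : H} {t : ℝ} (hΩ : ∀ y ∈ (Ω' : Set H), y + t • v ∈ (Ω : Set H)) :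
    HasWeakFDerivOn Ω' μ (diffQuot v t f) (fun y => innerSL ℝ (diffQuot v t g y)) := by
  refine hasWeakFDerivOn_congr (h.diffQuot μ hle hΩ) (fun y _ => rfl) (fun y _ => ?_)
  ext h'
  simp only [diffQuot, innerSL_apply_apply, Pi.smul_apply, Pi.sub_apply,
    FunLike.coe_smul, FunLike.coe_sub, inner_sub_left, real_inner_smul_left, smul_eq_mul]

namespace IsWeakNeumannHalfBall

omit [FiniteDimensional ℝ H] [BorelSpace H] in
/-- A weak solution is in `W^{1,2}(U_R)`. [folklore] -/
theorem memSobolevDomain (hsol : IsWeakNeumannHalfBall μ ν z R A F G u gu) :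
    MemSobolevDomain 1 2 (halfBall ν z R) μ u := by
  refine ⟨hsol.memLp, _, hsol.hasWeakFDerivOn, fun v => ?_⟩
  rw [memSobolevDomain_zero_iff]
  simpa only [innerSL_apply_apply] using memLp_inner_const hsol.memLp_grad v

set_option maxHeartbeats 1600000 in
/-- **The uniform `L²` bound on tangential difference quotients of the weak gradient**
(Evans, *PDE*, §6.3.2, proof of Theorem 4, steps 2–3; Taylor, *PDE I*, Ch. 5, (7.25)–(7.30)):
for `0 < r < R`, a unit tangential `v` and `0 < |t| ≤ (R - r)/4`,
`‖D^t_v ∇u‖_{L²(U_r)} ≤ C` with `C` independent of `t`. [cite: Evans2010, §6.3.2 Theorem 4 (proof, steps 2–3)] -/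
theorem eLpNorm_diffQuot_grad_le [μ.IsAddHaarMeasure]
    (hsol : IsWeakNeumannHalfBall μ ν z R A F G u gu) (hA : ContDiff ℝ 1 A) {lam : ℝ}
    (hlam : 0 < lam) (hell : ∀ y ∈ ball z R, ∀ ξ : H, lam * ‖ξ‖ ^ 2 ≤ ⟪A y ξ, ξ⟫) {r : ℝ}
    (hr : 0 < r) (hrR : r < R) {v : H} (hv : ⟪v, ν⟫ = 0) (hv1 : ‖v‖ = 1) :
    ∃ C : ℝ, ∀ t : ℝ, t ≠ 0 → |t| ≤ (R - r) / 4 →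
      eLpNorm (diffQuot v t gu) 2 (μ.restrict (halfBall ν z r : Set H)) ≤ ENNReal.ofReal C := by
  -- radii, the cut-off and the constants
  set δ : ℝ := (R - r) / 4 with hδ
  have hδ0 : 0 < δ := by rw [hδ]; linarith
  have hR0 : 0 < R := hr.trans hrR
  set U : Opens H := halfBall ν z R with hU
  set U₁ : Opens H := halfBall ν z (r + δ) with hU₁
  set U₂ : Opens H := halfBall ν z (r + 2 * δ) with hU₂
  set Ur : Opens H := halfBall ν z r with hUr
  set 𝓗 : Opens H := halfSpace ν z with h𝓗
  have hUm : MeasurableSet (U : Set H) := U.isOpen.measurableSet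
  have hU₂m : MeasurableSet (U₂ : Set H) := U₂.isOpen.measurableSet
  have h𝓗m : MeasurableSet (𝓗 : Set H) := 𝓗.isOpen.measurableSet
  have hUrm : MeasurableSet (Ur : Set H) := Ur.isOpen.measurableSet
  have hU₁U : U₁ ≤ U := halfBall_mono (by linarith)
  have hU₂U : U₂ ≤ U := halfBall_mono (by linarith)
  have hU₁U₂ : U₁ ≤ U₂ := halfBall_mono (by linarith)
  have hUrU₂ : Ur ≤ U₂ := halfBall_mono (by linarith)
  have hUrU : Ur ≤ U := halfBall_mono hrR.le
  have hU𝓗 : U ≤ 𝓗 := halfBall_le_halfSpace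
  have hU₂𝓗 : U₂ ≤ 𝓗 := halfBall_le_halfSpace
  let η : ContDiffBump z := ⟨r, r + δ, hr, by linarith⟩
  have hηrOut : η.rOut = r + δ := rfl
  have hηc : Continuous (η : H → ℝ) := η.continuous
  have hη1c : ContDiff ℝ 1 (η : H → ℝ) := η.contDiff
  have hηinf : ContDiff ℝ ∞ (η : H → ℝ) := η.contDiff
  have hη1 : ∀ y, |(η : H → ℝ) y| ≤ 1 := fun y => by
    rw [abs_of_nonneg η.nonneg]; exact η.le_one
  obtain ⟨Cη, hCη⟩ : ∃ C, ∀ y, ‖fderiv ℝ (η : H → ℝ) y‖ ≤ C :=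
    (η.hasCompactSupport.fderiv (𝕜 := ℝ)).exists_bound_of_continuous
      (hη1c.continuous_fderiv one_ne_zero)
  have hCη0 : 0 ≤ Cη := (norm_nonneg _).trans (hCη z)
  have hηsupp : support (η : H → ℝ) = ball z (r + δ) := η.support_eq
  have hηtsupp : tsupport (η : H → ℝ) = closedBall z (r + δ) := η.tsupport_eq
  have hη0 : ∀ y, r + δ ≤ dist y z → (η : H → ℝ) y = 0 := fun y hy => η.zero_of_le_dist hy
  have hDη0 : ∀ y, r + δ < dist y z → fderiv ℝ (η : H → ℝ) y = 0 := fun y hy => by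
    apply fderiv_of_notMem_tsupport
    rw [hηtsupp, mem_closedBall]; exact not_le.2 hy
  have hηone : ∀ y, dist y z < r → (η : H → ℝ) y = 1 := fun y hy =>
    η.one_of_mem_closedBall (mem_closedBall.2 hy.le)
  -- bounds for the coefficients on `B̄(z, 2R)`
  obtain ⟨M₀, hM₀0, hM₀⟩ := exists_bound_coeff hA.continuous z (2 * R)
  obtain ⟨M₁, hM₁0, hM₁⟩ := exists_bound_coeff (hA.continuous_fderiv one_ne_zero) z (2 * R)
  have hAd : ∀ x ∈ ball z (2 * R), DifferentiableAt ℝ A x := fun x _ =>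
    (hA.differentiable one_ne_zero) x
  have hM₁' : ∀ x ∈ ball z (2 * R), ‖fderiv ℝ A x‖ ≤ M₁ := fun x hx =>
    hM₁ x (ball_subset_closedBall hx)
  -- the `L²` sizes of the data
  set N_u : ℝ := (eLpNorm gu 2 (μ.restrict (U : Set H))).toReal with hN_u
  set N_F : ℝ := (eLpNorm F 2 (μ.restrict (U : Set H))).toReal with hN_F
  obtain ⟨hGm, DG, hDG, hDGk⟩ := hsol.memSobolev_flux
  set N_G : ℝ := (eLpNorm (fun y => DG y v) 2 (μ.restrict (U : Set H))).toReal with hN_G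
  have hN_u0 : 0 ≤ N_u := ENNReal.toReal_nonneg
  have hN_F0 : 0 ≤ N_F := ENNReal.toReal_nonneg
  have hN_G0 : 0 ≤ N_G := ENNReal.toReal_nonneg
  set α : ℝ := N_F + N_G + 2 * M₀ * Cη * N_u + M₁ * N_u with hα
  set β : ℝ := 2 * Cη * N_u * (N_F + N_G) + 2 * M₁ * Cη * N_u ^ 2 with hβ
  have hα0 : 0 ≤ α := by positivity
  have hβ0 : 0 ≤ β := by positivity
  refine ⟨α / lam + Real.sqrt (β / lam), fun t ht htδ => ?_⟩
  -- STEP 0: shifts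
  have htv : ‖t • v‖ = |t| := by rw [norm_smul, Real.norm_eq_abs, hv1, mul_one]
  have htv' : ‖(-t) • v‖ = |t| := by rw [norm_smul, Real.norm_eq_abs, abs_neg, hv1, mul_one]
  have hvt : ⟪t • v, ν⟫ = 0 := by rw [real_inner_smul_left, hv, mul_zero]
  have hvt' : ⟪(-t) • v, ν⟫ = 0 := by rw [real_inner_smul_left, hv, mul_zero]
  have hsh2 : ∀ y ∈ (U₂ : Set H), y + t • v ∈ (U : Set H) := fun y hy =>
    add_mem_halfBall hvt (by rw [htv]; linarith) hy
  have hsh1 : ∀ y ∈ (U₁ : Set H), y + t • v ∈ (U : Set H) := fun y hy =>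
    add_mem_halfBall hvt (by rw [htv]; linarith) hy
  have hseg2 : ∀ y ∈ (U₂ : Set H), ∀ s ∈ Icc (0:ℝ) 1, y + (s * t) • v ∈ (U : Set H) :=
    fun y hy s hs => add_smul_mem_halfBall hv (by rw [hv1, mul_one]; linarith) hy hs
  have hsh𝓗 : ∀ y ∈ (𝓗 : Set H), y + (-t) • v ∈ (𝓗 : Set H) := fun y hy =>
    add_mem_halfSpace hvt' hy
  have hseg𝓗 : ∀ y ∈ (𝓗 : Set H), ∀ s ∈ Icc (0:ℝ) 1, y + (s * -t) • v ∈ (𝓗 : Set H) :=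
    fun y hy s _ => add_mem_halfSpace (by rw [real_inner_smul_left, hv, mul_zero]) hy
  -- STEP 1: `w = D^t u`, `gw = D^t ∇u` on `U₂`
  set w : H → ℝ := diffQuot v t u with hw_def
  set gw : H → H := diffQuot v t gu with hgw_def
  have hw : HasWeakFDerivOn U₂ μ w (fun y => innerSL ℝ (gw y)) :=
    hasWeakFDerivOn_diffQuot_innerSL μ hsol.hasWeakFDerivOn hU₂U hsh2
  have hwS : MemSobolevDomain 1 2 U₂ μ w := hsol.memSobolevDomain.diffQuot μ hU₂U hsh2
  have hwm : MemLp w 2 (μ.restrict (U₂ : Set H)) := hwS.memLp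
  have hgwm : MemLp gw 2 (μ.restrict (U₂ : Set H)) := memLp_diffQuot μ hsol.memLp_grad hU₂U hsh2
  set W : ℝ := (eLpNorm w 2 (μ.restrict (U₂ : Set H))).toReal with hW_def
  have hW0 : 0 ≤ W := ENNReal.toReal_nonneg
  have hWN : W ≤ N_u := by
    have h1 := eLpNorm_diffQuot_le μ (p := 2) (by norm_num) (by norm_num) hsol.memSobolevDomain
      hsol.hasWeakFDerivOn hseg2 (v := v) (t := t)
    have h2 : eLpNorm (fun y => innerSL ℝ (gu y) v) 2 (μ.restrict (U : Set H)) ≤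
        eLpNorm gu 2 (μ.restrict (U : Set H)) := by
      refine eLpNorm_mono fun y => ?_
      rw [innerSL_apply_apply]
      calc ‖⟪gu y, v⟫‖ ≤ ‖gu y‖ * ‖v‖ := norm_inner_le_norm _ _
        _ = ‖gu y‖ := by rw [hv1, mul_one]
    exact ENNReal.toReal_mono hsol.memLp_grad.eLpNorm_ne_top (h1.trans h2)
  -- STEP 2: the zero-extended test pair `k = η² w`, `gk = ∇k` on the half-space
  have hηs : tsupport (η : H → ℝ) ∩ (𝓗 : Set H) ⊆ (U₂ : Set H) := by
    rw [hηtsupp]; intro y hy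
    exact ⟨mem_ball.2 (lt_of_le_of_lt (mem_closedBall.1 hy.1) (by linarith)), hy.2⟩
  set k : H → ℝ := cutoffTest (U₂ : Set H) η w with hk_def
  set gk : H → H := cutoffTestGrad (U₂ : Set H) η w gw with hgk_def
  have hk : HasWeakFDerivOn 𝓗 μ k (fun y => innerSL ℝ (gk y)) :=
    hasWeakFDerivOn_cutoffTest hw hwm hgwm hηinf hηs
  have hkm : MemLp k 2 (μ.restrict (𝓗 : Set H)) := memLp_cutoffTest hwm hηc hη1
  have hgkm : MemLp gk 2 (μ.restrict (𝓗 : Set H)) := memLp_cutoffTestGrad hwm hgwm hη1c hη1 hCη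
  have hksupp : support k ⊆ (U₁ : Set H) := fun y hy => by
    have h := support_cutoffTest_subset (U₂ : Set H) η w hy
    rw [hηsupp] at h
    exact ⟨h.2, h.1.2⟩
  have hgksupp : support gk ⊆ (U₁ : Set H) := fun y hy => by
    have h := support_cutoffTestGrad_subset (U₂ : Set H) η w gw hy
    rw [hηsupp] at h
    exact ⟨h.2, h.1.2⟩
  have hksupp' : support k ⊆ ball z (r + δ) := hksupp.trans halfBall_subset_ball
  have hgksupp' : support gk ⊆ ball z (r + δ) := hgksupp.trans halfBall_subset_ball
  have hgk0 : ∀ y, y ∉ (U₂ : Set H) → gk y = 0 := fun y hy =>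
    notMem_support.1 fun h => hy (hU₁U₂ (hgksupp h))
  have hkS : MemSobolevDomain 1 2 𝓗 μ k := by
    refine ⟨hkm, _, hk, fun v' => ?_⟩
    rw [memSobolevDomain_zero_iff]
    simpa only [innerSL_apply_apply] using memLp_inner_const hgkm v'
  -- STEP 3: the shifted test pair `ζ = D^{-t} k`, `gζ = D^{-t} gk`
  set ζ : H → ℝ := diffQuot v (-t) k with hζ_def
  set gζ : H → H := diffQuot v (-t) gk with hgζ_def
  have hζ𝓗 : HasWeakFDerivOn 𝓗 μ ζ (fun y => innerSL ℝ (gζ y)) :=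
    hasWeakFDerivOn_diffQuot_innerSL μ hk le_rfl hsh𝓗
  have hζU : HasWeakFDerivOn U μ ζ (fun y => innerSL ℝ (gζ y)) :=
    HasWeakFDerivOn.mono_set_holds hζ𝓗 hU𝓗
  have hζm𝓗 : MemLp ζ 2 (μ.restrict (𝓗 : Set H)) := memLp_diffQuot μ hkm le_rfl hsh𝓗
  have hgζm𝓗 : MemLp gζ 2 (μ.restrict (𝓗 : Set H)) := memLp_diffQuot μ hgkm le_rfl hsh𝓗
  have hζm : MemLp ζ 2 (μ.restrict (U : Set H)) :=
    hζm𝓗.mono_measure (Measure.restrict_mono_set μ hU𝓗)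
  have hgζm : MemLp gζ 2 (μ.restrict (U : Set H)) :=
    hgζm𝓗.mono_measure (Measure.restrict_mono_set μ hU𝓗)
  have hζ0 : ∀ y, r + 3 * δ ≤ dist y z → ζ y = 0 := fun y hy =>
    diffQuot_eq_zero_of_support_subset hksupp' (by rw [htv']; linarith)
  have hgζ0 : ∀ y, r + 3 * δ ≤ dist y z → gζ y = 0 := fun y hy =>
    diffQuot_eq_zero_of_support_subset hgksupp' (by rw [htv']; linarith)
  -- STEP 4: the weak formulation tested with `ζ`
  have hWI := hsol.weak_eq_extend hA.continuous hζm (memLp_innerSL_comp hgζm) hζU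
    (ρ₁ := r + 3 * δ) (by positivity) (by linarith) (fun y _ hy => hζ0 y hy)
    (fun y _ hy => by rw [hgζ0 y hy, map_zero])
  simp only [innerSL_apply_apply] at hWI
  -- STEP 5: the data in `L²(U)` and the discrete integrations by parts
  have hUball2 : ∀ y ∈ (U : Set H), y ∈ ball z (2 * R) := fun y hy =>
    mem_ball.2 (lt_of_lt_of_le (mem_ball.1 (halfBall_subset_ball hy)) (by linarith))
  have hUball2' : ∀ y ∈ (U : Set H), y + t • v ∈ ball z (2 * R) := fun y hy => by
    rw [mem_ball, dist_eq_norm]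
    calc ‖y + t • v - z‖ = ‖(y - z) + t • v‖ := by abel_nf
      _ ≤ ‖y - z‖ + ‖t • v‖ := norm_add_le _ _
      _ < R + δ := by
          rw [htv, ← dist_eq_norm]; exact add_lt_add_of_lt_of_le (mem_ball.1 (halfBall_subset_ball hy)) htδ
      _ ≤ 2 * R := by linarith
  obtain ⟨ham, -⟩ := memLp_coeff_apply hUm hA.continuous hM₀0
    (fun y hy => hM₀ y (ball_subset_closedBall (hUball2 y hy))) hsol.memLp_grad
  have hFm : MemLp F 2 (μ.restrict (U : Set H)) := hsol.memLp_source
  have hGm' : MemLp G 2 (μ.restrict (U : Set H)) := hGm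
  have hgkmU : MemLp gk 2 (μ.restrict (U : Set H)) :=
    hgkm.mono_measure (Measure.restrict_mono_set μ hU𝓗)
  have hgkmU₂ : MemLp gk 2 (μ.restrict (U₂ : Set H)) :=
    hgkm.mono_measure (Measure.restrict_mono_set μ hU₂𝓗)
  -- IBP for the principal part
  have hIBP_A : ∫ y in (U : Set H), ⟪A y (gu y), gζ y⟫ ∂μ =
      -∫ y in (U : Set H), ⟪diffQuot v t (fun y => A y (gu y)) y, gk y⟫ ∂μ := by
    refine setIntegral_inner_diffQuot_neg_eq μ hgksupp hU₁U hsh1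
      (integrable_inner_of_memLp_two ham hgkmU) ?_
    have h2 : MemLp (fun y => A (y + t • v) (gu (y + t • v))) 2 (μ.restrict (U₂ : Set H)) :=
      memLp_comp_add μ (f := fun y => A y (gu y)) ham hsh2
    exact IntegrableOn.of_forall_sdiff_eq_zero (integrable_inner_of_memLp_two h2 hgkmU₂) hUm
      (fun y hy => by rw [hgk0 y hy.2, inner_zero_right])
  have hIBP_G : ∫ y in (U : Set H), ⟪G y, gζ y⟫ ∂μ =
      -∫ y in (U : Set H), ⟪diffQuot v t G y, gk y⟫ ∂μ := by
    refine setIntegral_inner_diffQuot_neg_eq μ hgksupp hU₁U hsh1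
      (integrable_inner_of_memLp_two hGm' hgkmU) ?_
    exact IntegrableOn.of_forall_sdiff_eq_zero
      (integrable_inner_of_memLp_two (memLp_comp_add μ hGm' hsh2) hgkmU₂) hUm
      (fun y hy => by rw [hgk0 y hy.2, inner_zero_right])
  -- STEP 6: the four terms of `⟪D^t(A∇u), gk⟫`
  set P : H → H := fun y => (η : H → ℝ) y • gw y with hP_def
  set Q : H → H := fun y => (η : H → ℝ) y • gu y with hQ_def
  set Wg : H → H := fun y => w y • gradient (η : H → ℝ) y with hWg_def
  set A₁ : H → H →L[ℝ] H := fun y => A (y + t • v) with hA₁_def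
  set Dta : H → H →L[ℝ] H := diffQuot v t A with hDta_def
  have hgkU : ∀ y ∈ (U : Set H), gk y = (η : H → ℝ) y • P y + (2 * (η : H → ℝ) y * w y) •
      gradient (η : H → ℝ) y := fun y hy => by
    by_cases hy2 : y ∈ (U₂ : Set H)
    · rw [hgk_def, cutoffTestGrad, indicator_of_mem hy2, hP_def, smul_smul]
    · have hd : r + 2 * δ ≤ dist y z := by
        by_contra hlt
        exact hy2 ⟨mem_ball.2 (not_le.1 hlt), hy.2⟩
      rw [hgk0 y hy2, hη0 y (by linarith), zero_smul, mul_zero, zero_mul, zero_smul, add_zero]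
  have hpt : ∀ y ∈ (U : Set H), ⟪diffQuot v t (fun y => A y (gu y)) y, gk y⟫ =
      ⟪A₁ y (P y), P y⟫ + 2 * ⟪A₁ y (P y), Wg y⟫ + ⟪Dta y (Q y), P y⟫ + 2 * ⟪Dta y (Q y), Wg y⟫ :=
    fun y hy => by
      rw [diffQuot_coeff_apply, hgkU y hy, hP_def, hQ_def, hWg_def, hA₁_def, hDta_def, hgw_def]
      exact inner_energy_expand _ _ _ _ _ _ _
  -- `L²(U)` membership of `P`, `Q`, `Wg`, `A₁ P`, `Dta Q`
  have hPm₂ : MemLp P 2 (μ.restrict (U₂ : Set H)) :=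
    hgwm.of_le_mul (c := 1) (hηc.aestronglyMeasurable.smul hgwm.1)
      (Eventually.of_forall fun y => by
        rw [hP_def, norm_smul, Real.norm_eq_abs, one_mul]
        exact mul_le_of_le_one_left (norm_nonneg _) (hη1 y))
  have hP0 : ∀ y ∈ (U : Set H), y ∉ (U₂ : Set H) → P y = 0 := fun y hy hy2 => by
    have hd : r + 2 * δ ≤ dist y z := by
      by_contra hlt
      exact hy2 ⟨mem_ball.2 (not_le.1 hlt), hy.2⟩
    rw [hP_def]; simp only [hη0 y (by linarith), zero_smul]
  have hPm : MemLp P 2 (μ.restrict (U : Set H)) := memLp_of_forall_sdiff_eq_zero hU₂m hUm hU₂U hPm₂ hP0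
  have hQm : MemLp Q 2 (μ.restrict (U : Set H)) :=
    hsol.memLp_grad.of_le_mul (c := 1) (hηc.aestronglyMeasurable.smul hsol.memLp_grad.1)
      (Eventually.of_forall fun y => by
        rw [hQ_def, norm_smul, Real.norm_eq_abs, one_mul]
        exact mul_le_of_le_one_left (norm_nonneg _) (hη1 y))
  have hgradc : Continuous (gradient (η : H → ℝ)) :=
    (InnerProductSpace.toDual ℝ H).symm.continuous.comp (hη1c.continuous_fderiv one_ne_zero)
  have hWgle : ∀ y, ‖Wg y‖ ≤ Cη * ‖w y‖ := fun y => by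
    rw [hWg_def, norm_smul, norm_gradient_eq, mul_comm]
    exact mul_le_mul_of_nonneg_right (hCη y) (norm_nonneg _)
  have hWgm₂ : MemLp Wg 2 (μ.restrict (U₂ : Set H)) :=
    hwm.of_le_mul (c := Cη) (hwm.1.smul hgradc.aestronglyMeasurable) (Eventually.of_forall hWgle)
  have hWg0 : ∀ y ∈ (U : Set H), y ∉ (U₂ : Set H) → Wg y = 0 := fun y hy hy2 => by
    have hd : r + 2 * δ ≤ dist y z := by
      by_contra hlt
      exact hy2 ⟨mem_ball.2 (not_le.1 hlt), hy.2⟩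
    show w y • gradient (η : H → ℝ) y = 0
    rw [gradient, hDη0 y (by linarith), map_zero, smul_zero]
  have hWgm : MemLp Wg 2 (μ.restrict (U : Set H)) :=
    memLp_of_forall_sdiff_eq_zero hU₂m hUm hU₂U hWgm₂ hWg0
  have hA₁c : Continuous A₁ := hA.continuous.comp (continuous_id.add continuous_const)
  obtain ⟨hA₁Pm, hA₁Pn⟩ := memLp_coeff_apply hUm hA₁c hM₀0
    (fun y hy => hM₀ _ (ball_subset_closedBall (hUball2' y hy))) hPm
  have hDtac : Continuous Dta := by
    have : Dta = fun y => t⁻¹ • (A (y + t • v) - A y) := by funext y; rfl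
    rw [this]
    exact (continuous_const (y := t⁻¹)).smul
      ((hA.continuous.comp (continuous_id.add continuous_const)).sub hA.continuous)
  have hDtaM : ∀ y ∈ (U : Set H), ‖Dta y‖ ≤ M₁ := fun y hy =>
    norm_diffQuot_le_of_norm_fderiv_le (convex_ball z (2 * R)) hAd hM₁' hv1 (hUball2 y hy)
      (hUball2' y hy)
  obtain ⟨hDQm, hDQn⟩ := memLp_coeff_apply hUm hDtac hM₁0 hDtaM hQm
  -- the real sizes
  set X : ℝ := (eLpNorm P 2 (μ.restrict (U : Set H))).toReal with hX_def
  have hX0 : 0 ≤ X := ENNReal.toReal_nonneg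
  have hQn : (eLpNorm Q 2 (μ.restrict (U : Set H))).toReal ≤ N_u := by
    have := toReal_eLpNorm_le_mul_of_ae_le (f := Q) hsol.memLp_grad zero_le_one
      (Eventually.of_forall fun y => by
        rw [hQ_def, norm_smul, Real.norm_eq_abs, one_mul]
        exact mul_le_of_le_one_left (norm_nonneg _) (hη1 y))
    rwa [one_mul] at this
  have hWgn : (eLpNorm Wg 2 (μ.restrict (U : Set H))).toReal ≤ Cη * W := by
    rw [eLpNorm_restrict_eq_of_forall_eq_zero hU₂m hUm hU₂U hWg0]
    exact toReal_eLpNorm_le_mul_of_ae_le hwm hCη0 (Eventually.of_forall hWgle)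
  have hPn₂ : (eLpNorm P 2 (μ.restrict (U₂ : Set H))).toReal ≤ X :=
    ENNReal.toReal_mono hPm.eLpNorm_ne_top (eLpNorm_mono_measure P (Measure.restrict_mono_set μ hU₂U))
  -- `‖gk‖_{L²(U₂)} ≤ X + 2 Cη W`
  set Z : ℝ := X + 2 * Cη * W with hZ_def
  have hgkn : (eLpNorm gk 2 (μ.restrict (U₂ : Set H))).toReal ≤ Z := by
    have e : ∀ᵐ y ∂(μ.restrict (U₂ : Set H)), gk y =
        ((fun y => (η : H → ℝ) y • P y) + fun y => (2 * (η : H → ℝ) y) • Wg y) y := by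
      rw [ae_restrict_iff' hU₂m]
      refine Eventually.of_forall fun y hy => ?_
      simp only [Pi.add_apply, hgkU y (hU₂U hy), hWg_def, smul_smul]
    rw [eLpNorm_congr_ae e]
    have h1 : MemLp (fun y => (η : H → ℝ) y • P y) 2 (μ.restrict (U₂ : Set H)) :=
      hPm₂.of_le_mul (c := 1) (hηc.aestronglyMeasurable.smul hPm₂.1)
        (Eventually.of_forall fun y => by
          rw [norm_smul, Real.norm_eq_abs, one_mul]
          exact mul_le_of_le_one_left (norm_nonneg _) (hη1 y))
    have h2 : MemLp (fun y => (2 * (η : H → ℝ) y) • Wg y) 2 (μ.restrict (U₂ : Set H)) :=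
      hWgm₂.of_le_mul (c := 2) ((continuous_const.mul hηc).aestronglyMeasurable.smul hWgm₂.1)
        (Eventually.of_forall fun y => by
          rw [norm_smul, norm_mul, Real.norm_ofNat, Real.norm_eq_abs]
          calc 2 * |(η : H → ℝ) y| * ‖Wg y‖ ≤ 2 * 1 * ‖Wg y‖ := by gcongr; exact hη1 y
            _ = 2 * ‖Wg y‖ := by ring)
    refine (toReal_eLpNorm_add_le h1 h2).trans (add_le_add ?_ ?_)
    · have := toReal_eLpNorm_le_mul_of_ae_le (f := fun y => (η : H → ℝ) y • P y) hPm₂ zero_le_one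
        (Eventually.of_forall fun y => by
          rw [norm_smul, Real.norm_eq_abs, one_mul]
          exact mul_le_of_le_one_left (norm_nonneg _) (hη1 y))
      rw [one_mul] at this
      exact this.trans hPn₂
    · have := toReal_eLpNorm_le_mul_of_ae_le (f := fun y => (2 * (η : H → ℝ) y) • Wg y) hWgm₂
        zero_le_two (Eventually.of_forall fun y => by
          rw [norm_smul, norm_mul, Real.norm_ofNat, Real.norm_eq_abs]
          calc 2 * |(η : H → ℝ) y| * ‖Wg y‖ ≤ 2 * 1 * ‖Wg y‖ := by gcongr; exact hη1 y
            _ = 2 * ‖Wg y‖ := by ring)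
      refine this.trans ?_
      rw [eLpNorm_restrict_eq_of_forall_eq_zero hU₂m hUm hU₂U hWg0] at hWgn
      calc 2 * (eLpNorm Wg 2 (μ.restrict (U₂ : Set H))).toReal ≤ 2 * (Cη * W) := by gcongr
        _ = 2 * Cη * W := by ring
  have hZ0 : 0 ≤ Z := by positivity
  -- STEP 7: bounds for the five integrals
  -- (i) the source term
  have hI_F : |∫ y in (U : Set H), F y * ζ y ∂μ| ≤ N_F * Z := by
    refine (abs_integral_mul_le_L2 hFm hζm).trans (mul_le_mul_of_nonneg_left ?_ hN_F0)
    have h1 : eLpNorm ζ 2 (μ.restrict (U : Set H)) ≤ eLpNorm ζ 2 (μ.restrict (𝓗 : Set H)) :=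
      eLpNorm_mono_measure ζ (Measure.restrict_mono_set μ hU𝓗)
    have h2 := eLpNorm_diffQuot_le μ (p := 2) (by norm_num) (by norm_num) hkS hk hseg𝓗 (v := v)
    have h3 : eLpNorm (fun y => innerSL ℝ (gk y) v) 2 (μ.restrict (𝓗 : Set H)) ≤
        eLpNorm gk 2 (μ.restrict (𝓗 : Set H)) := by
      refine eLpNorm_mono fun y => ?_
      rw [innerSL_apply_apply]
      calc ‖⟪gk y, v⟫‖ ≤ ‖gk y‖ * ‖v‖ := norm_inner_le_norm _ _
        _ = ‖gk y‖ := by rw [hv1, mul_one]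
    have h4 : eLpNorm gk 2 (μ.restrict (𝓗 : Set H)) = eLpNorm gk 2 (μ.restrict (U₂ : Set H)) :=
      eLpNorm_restrict_eq_of_forall_eq_zero hU₂m h𝓗m hU₂𝓗 (fun y _ hy => hgk0 y hy) 2
    calc (eLpNorm ζ 2 (μ.restrict (U : Set H))).toReal
        ≤ (eLpNorm gk 2 (μ.restrict (U₂ : Set H))).toReal :=
          ENNReal.toReal_mono hgkmU₂.eLpNorm_ne_top ((h1.trans h2).trans (h3.trans h4.le))
      _ ≤ Z := hgkn
  -- (ii) the flux term
  have hI_G : |∫ y in (U : Set H), ⟪diffQuot v t G y, gk y⟫ ∂μ| ≤ N_G * Z := by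
    have hDGm : MemLp (diffQuot v t G) 2 (μ.restrict (U₂ : Set H)) := memLp_diffQuot μ hGm' hU₂U hsh2
    rw [setIntegral_eq_of_subset_of_forall_sdiff_eq_zero hUm hU₂U
      (fun y hy => by rw [hgk0 y hy.2, inner_zero_right])]
    refine (abs_integral_inner_le hDGm hgkmU₂).trans ?_
    refine mul_le_mul ?_ hgkn ENNReal.toReal_nonneg hN_G0
    have h1 := eLpNorm_diffQuot_le μ (p := 2) (by norm_num) (by norm_num) ⟨hGm, DG, hDG, hDGk⟩ hDG
      hseg2 (v := v) (t := t)
    exact ENNReal.toReal_mono (hDGk v).memLp.eLpNorm_ne_top h1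
  -- (iii) the three lower-order terms
  have hI₂ : |∫ y in (U : Set H), ⟪A₁ y (P y), Wg y⟫ ∂μ| ≤ M₀ * X * (Cη * W) :=
    (abs_integral_inner_le hA₁Pm hWgm).trans
      (mul_le_mul hA₁Pn hWgn ENNReal.toReal_nonneg (by positivity))
  have hI₃ : |∫ y in (U : Set H), ⟪Dta y (Q y), P y⟫ ∂μ| ≤ M₁ * N_u * X := by
    refine (abs_integral_inner_le hDQm hPm).trans (mul_le_mul_of_nonneg_right ?_ hX0)
    exact hDQn.trans (mul_le_mul_of_nonneg_left hQn hM₁0)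
  have hI₄ : |∫ y in (U : Set H), ⟪Dta y (Q y), Wg y⟫ ∂μ| ≤ M₁ * N_u * (Cη * W) := by
    refine (abs_integral_inner_le hDQm hWgm).trans ?_
    exact mul_le_mul (hDQn.trans (mul_le_mul_of_nonneg_left hQn hM₁0)) hWgn
      ENNReal.toReal_nonneg (by positivity)
  -- (iv) the principal term is coercive
  have hPsq : Integrable (fun y => ‖P y‖ ^ 2) (μ.restrict (U : Set H)) :=
    (memLp_two_iff_integrable_sq_norm hPm.1).1 hPm
  have hI₁ : lam * X ^ 2 ≤ ∫ y in (U : Set H), ⟪A₁ y (P y), P y⟫ ∂μ := by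
    have hXsq : ∫ y in (U : Set H), ‖P y‖ ^ 2 ∂μ = X ^ 2 := integral_norm_sq_eq_toReal_eLpNorm_two_sq hPm
    rw [← hXsq, ← integral_const_mul]
    refine setIntegral_mono_on (hPsq.const_mul _) (integrable_inner_of_memLp_two hA₁Pm hPm) hUm
      fun y hy => ?_
    by_cases hPy : P y = 0
    · simp [hPy]
    · have hηy : (η : H → ℝ) y ≠ 0 := fun h0 => hPy (by rw [hP_def]; simp only [h0, zero_smul])
      have hyb : y ∈ ball z (r + δ) := by rw [← hηsupp]; exact mem_support.2 hηy
      refine hell (y + t • v) ?_ (P y)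
      rw [mem_ball, dist_eq_norm]
      calc ‖y + t • v - z‖ = ‖(y - z) + t • v‖ := by abel_nf
        _ ≤ ‖y - z‖ + ‖t • v‖ := norm_add_le _ _
        _ < (r + δ) + δ := by
            rw [htv, ← dist_eq_norm]; exact add_lt_add_of_lt_of_le (mem_ball.1 hyb) htδ
        _ ≤ R := by linarith
  -- STEP 8: the identity and the conclusion `λ X² ≤ α X + β`
  have hi₁ : Integrable (fun y => ⟪A₁ y (P y), P y⟫) (μ.restrict (U : Set H)) :=
    integrable_inner_of_memLp_two hA₁Pm hPm
  have hi₂ : Integrable (fun y => ⟪A₁ y (P y), Wg y⟫) (μ.restrict (U : Set H)) :=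
    integrable_inner_of_memLp_two hA₁Pm hWgm
  have hi₃ : Integrable (fun y => ⟪Dta y (Q y), P y⟫) (μ.restrict (U : Set H)) :=
    integrable_inner_of_memLp_two hDQm hPm
  have hi₄ : Integrable (fun y => ⟪Dta y (Q y), Wg y⟫) (μ.restrict (U : Set H)) :=
    integrable_inner_of_memLp_two hDQm hWgm
  have hsum : ∫ y in (U : Set H), ⟪diffQuot v t (fun y => A y (gu y)) y, gk y⟫ ∂μ =
      (∫ y in (U : Set H), ⟪A₁ y (P y), P y⟫ ∂μ) + 2 * (∫ y in (U : Set H), ⟪A₁ y (P y), Wg y⟫ ∂μ) +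
        (∫ y in (U : Set H), ⟪Dta y (Q y), P y⟫ ∂μ) +
          2 * (∫ y in (U : Set H), ⟪Dta y (Q y), Wg y⟫ ∂μ) := by
    rw [setIntegral_congr_fun hUm hpt, integral_add, integral_add, integral_add, integral_const_mul,
      integral_const_mul]
    · exact hi₁
    · exact hi₂.const_mul 2
    · exact hi₁.add (hi₂.const_mul 2)
    · exact hi₃
    · exact (hi₁.add (hi₂.const_mul 2)).add hi₃
    · exact hi₄.const_mul 2
  have hlhs : ∫ y in (U : Set H), ⟪gζ y, A y (gu y)⟫ ∂μ =
      -∫ y in (U : Set H), ⟪diffQuot v t (fun y => A y (gu y)) y, gk y⟫ ∂μ := by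
    rw [← hIBP_A]
    exact setIntegral_congr_fun hUm fun y _ => real_inner_comm _ _
  have hrhs : ∫ y in (U : Set H), (F y * ζ y + ⟪gζ y, G y⟫) ∂μ =
      (∫ y in (U : Set H), F y * ζ y ∂μ) - ∫ y in (U : Set H), ⟪diffQuot v t G y, gk y⟫ ∂μ := by
    rw [integral_add (memLp_one_iff_integrable.1 (hζm.mul' hFm)) (integrable_inner_of_memLp_two hgζm hGm'),
      sub_eq_add_neg, ← hIBP_G]
    congr 1
    exact setIntegral_congr_fun hUm fun y _ => real_inner_comm _ _
  have hmain : lam * X ^ 2 ≤ α * X + β := by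
    have key : (∫ y in (U : Set H), ⟪A₁ y (P y), P y⟫ ∂μ) =
        -(∫ y in (U : Set H), F y * ζ y ∂μ) + (∫ y in (U : Set H), ⟪diffQuot v t G y, gk y⟫ ∂μ) -
          2 * (∫ y in (U : Set H), ⟪A₁ y (P y), Wg y⟫ ∂μ) -
            (∫ y in (U : Set H), ⟪Dta y (Q y), P y⟫ ∂μ) -
              2 * (∫ y in (U : Set H), ⟪Dta y (Q y), Wg y⟫ ∂μ) := by
      have h := hWI
      rw [hlhs, hrhs, hsum] at h
      linarith
    have hb := abs_le.1 hI_F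
    have hc := abs_le.1 hI_G
    have hd := abs_le.1 hI₂
    have he := abs_le.1 hI₃
    have hf := abs_le.1 hI₄
    have h1 : lam * X ^ 2 ≤ N_F * Z + N_G * Z + 2 * (M₀ * X * (Cη * W)) + M₁ * N_u * X +
        2 * (M₁ * N_u * (Cη * W)) := by linarith [hI₁]
    have h2 : N_F * Z + N_G * Z + 2 * (M₀ * X * (Cη * W)) + M₁ * N_u * X +
        2 * (M₁ * N_u * (Cη * W)) ≤ α * X + β := by
      rw [hα, hβ, hZ_def]
      have hWN' : Cη * W ≤ Cη * N_u := mul_le_mul_of_nonneg_left hWN hCη0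
      have ha := mul_le_mul_of_nonneg_left hWN' (by positivity : 0 ≤ 2 * (N_F + N_G))
      have hb := mul_le_mul_of_nonneg_left hWN' (by positivity : 0 ≤ 2 * M₀ * X)
      have hc := mul_le_mul_of_nonneg_left hWN' (by positivity : 0 ≤ 2 * M₁ * N_u)
      linarith
    exact h1.trans h2
  have hXle : X ≤ α / lam + Real.sqrt (β / lam) := le_of_sq_le_affine hlam hα0 hβ0 hmain
  -- STEP 9: `‖D^t ∇u‖_{L²(U_r)} ≤ X`
  have e : ∀ᵐ y ∂(μ.restrict (Ur : Set H)), gw y = P y := by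
    rw [ae_restrict_iff' hUrm]
    refine Eventually.of_forall fun y hy => ?_
    rw [hP_def]; simp only [hηone y (mem_ball.1 (halfBall_subset_ball hy)), one_smul]
  calc eLpNorm gw 2 (μ.restrict (Ur : Set H)) = eLpNorm P 2 (μ.restrict (Ur : Set H)) :=
        eLpNorm_congr_ae e
    _ ≤ eLpNorm P 2 (μ.restrict (U : Set H)) := eLpNorm_mono_measure P (Measure.restrict_mono_set μ hUrU)
    _ = ENNReal.ofReal X := (ENNReal.ofReal_toReal hPm.eLpNorm_ne_top).symm
    _ ≤ ENNReal.ofReal (α / lam + Real.sqrt (β / lam)) := ENNReal.ofReal_le_ofReal hXle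

/-- **Tangential regularity, unit directions** (Evans, *PDE*, §6.3.2, Theorem 4, proof, step 3
with §5.8.2 Theorem 3 (ii)): for a unit tangential `v`, the weak gradient `∇u` has a weak
derivative along `v` in `L²(U_r; H)`. [cite: Evans2010, §6.3.2 Theorem 4 (proof, step 3)] -/
theorem exists_hasWeakDerivAlong_tangential_unit [μ.IsAddHaarMeasure]
    (hsol : IsWeakNeumannHalfBall μ ν z R A F G u gu) (hA : ContDiff ℝ 1 A) {lam : ℝ}
    (hlam : 0 < lam) (hell : ∀ y ∈ ball z R, ∀ ξ : H, lam * ‖ξ‖ ^ 2 ≤ ⟪A y ξ, ξ⟫) {r : ℝ}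
    (hr : 0 < r) (hrR : r < R) {v : H} (hv : ⟪v, ν⟫ = 0) (hv1 : ‖v‖ = 1) :
    ∃ gv : H → H, MemLp gv 2 (μ.restrict (halfBall ν z r : Set H)) ∧
      HasWeakDerivAlong (halfBall ν z r) μ (fun _ => v) gu gv := by
  obtain ⟨C, hC⟩ := hsol.eLpNorm_diffQuot_grad_le hA hlam hell hr hrR hv hv1
  set δ : ℝ := (R - r) / 4 with hδ
  have hδ0 : 0 < δ := by rw [hδ]; linarith
  set t : ℕ → ℝ := fun n => δ * (1 / ((n : ℝ) + 1)) with ht_def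
  have htpos : ∀ n, 0 < t n := fun n => by rw [ht_def]; positivity
  have ht0 : ∀ n, t n ≠ 0 := fun n => (htpos n).ne'
  have htle : ∀ n, |t n| ≤ δ := fun n => by
    rw [abs_of_pos (htpos n), ht_def]
    dsimp only
    rw [mul_one_div]
    exact div_le_self hδ0.le (by
      have : (0 : ℝ) ≤ n := n.cast_nonneg
      linarith)
  have htlim : Tendsto t atTop (𝓝 0) := by
    have := tendsto_one_div_add_atTop_nhds_zero_nat.const_mul δ
    rw [mul_zero] at this
    exact this
  set Ur : Opens H := halfBall ν z r with hUr
  set U : Opens H := halfBall ν z R with hU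
  have hUrU : Ur ≤ U := halfBall_mono hrR.le
  have hΩ : ∀ n, ∀ y ∈ (Ur : Set H), y + t n • v ∈ (U : Set H) := fun n y hy =>
    add_mem_halfBall (by rw [real_inner_smul_left, hv, mul_zero])
      (by rw [norm_smul, Real.norm_eq_abs, hv1, mul_one]; linarith [htle n]) hy
  have hfin : μ (Ur : Set H) ≠ ⊤ := (measure_halfBall_lt_top μ).ne
  haveI : IsFiniteMeasure (μ.restrict (U : Set H)) :=
    ⟨by rw [Measure.restrict_apply_univ]; exact measure_halfBall_lt_top μ⟩
  set b := stdOrthonormalBasis ℝ H with hb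
  have hb1 : ∀ i, ‖b i‖ = 1 := fun i => b.orthonormal.1 i
  have hcomp : ∀ i, ∃ w' : H → ℝ, MemLp w' 2 (μ.restrict (Ur : Set H)) ∧
      HasWeakDerivAlong Ur μ (fun _ => v) (fun y => ⟪b i, gu y⟫) w' := by
    intro i
    have hwim : MemLp (fun y => ⟪b i, gu y⟫) 2 (μ.restrict (U : Set H)) :=
      hsol.memLp_grad.of_le_mul (c := 1) (aestronglyMeasurable_const.inner hsol.memLp_grad.1)
        (Eventually.of_forall fun y => by
          calc ‖⟪b i, gu y⟫‖ ≤ ‖b i‖ * ‖gu y‖ := norm_inner_le_norm _ _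
            _ = 1 * ‖gu y‖ := by rw [hb1])
    have hwI : IntegrableOn (fun y => ⟪b i, gu y⟫) (U : Set H) μ := hwim.integrable (by norm_num)
    have hw : LocallyIntegrableOn (fun y => ⟪b i, gu y⟫) (U : Set H) μ := hwI.locallyIntegrableOn
    have hbd : ∀ n, eLpNorm (diffQuot v (t n) (fun y => ⟪b i, gu y⟫)) 2 (μ.restrict (Ur : Set H)) ≤
        ENNReal.ofReal C := fun n => by
      refine le_trans (eLpNorm_mono fun y => ?_) (hC (t n) (ht0 n) (htle n))
      have e : diffQuot v (t n) (fun y => ⟪b i, gu y⟫) y = ⟪b i, diffQuot v (t n) gu y⟫ := by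
        simp only [diffQuot, inner_sub_right, real_inner_smul_right, smul_eq_mul]
      rw [e]
      calc ‖⟪b i, diffQuot v (t n) gu y⟫‖ ≤ ‖b i‖ * ‖diffQuot v (t n) gu y‖ := norm_inner_le_norm _ _
        _ = ‖diffQuot v (t n) gu y‖ := by rw [hb1, one_mul]
    obtain ⟨w', hw'm, -, hw'd⟩ := exists_hasWeakDerivAlong_of_eLpNorm_diffQuot_le μ hUrU hfin hw
      hwim.1 ht0 htlim hΩ ENNReal.ofReal_ne_top hbd
    exact ⟨w', hw'm, hw'd⟩
  choose w' hw'm hw'd using hcomp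
  refine ⟨fun y => ∑ i, w' i y • b i, memLp_finsetSum _ (fun i _ => ?_), ?_⟩
  · exact (hw'm i).of_le_mul (c := ‖b i‖) ((hw'm i).1.smul_const (b i))
      (Eventually.of_forall fun x => by rw [norm_smul, mul_comm])
  have hX1 : ContDiff ℝ 1 (fun _ : H => v) := contDiff_const
  have hterm : ∀ i, HasWeakDerivAlong Ur μ (fun _ => v) (fun y => ⟪b i, gu y⟫ • b i)
      (fun y => w' i y • b i) := fun i => by
    have := (hw'd i).clm_apply hX1 (ContinuousLinearMap.toSpanSingleton ℝ (b i))
    simpa only [ContinuousLinearMap.toSpanSingleton_apply] using this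
  have hsum := HasWeakDerivAlong.finset_sum hX1 Finset.univ (fun i _ => hterm i)
  refine hsum.congr (Eventually.of_forall fun y => ?_)
  exact b.sum_repr' (gu y)

/-- **Tangential `H²`-regularity at the flat boundary for weak solutions of the Neumann problem**
(Evans, *PDE*, §6.3.2, Theorem 4, proof, steps 1–3; Taylor, *PDE I*, Ch. 5 §7, (7.25)–(7.30)):
for `0 < r < R` and every tangential direction `v` (`⟪v, ν⟫ = 0`), the weak gradient `∇u` of a
weak solution on the half-ball `U_R` (coefficients `C¹` and uniformly elliptic on `B(z,R)`,
`F ∈ L²`, `G ∈ W^{1,2}`) has a weak derivative along `v` lying in `L²(U_r; H)`.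
[cite: Evans2010, §6.3.2 Theorem 4] -/
theorem exists_hasWeakDerivAlong_tangential [μ.IsAddHaarMeasure]
    (hsol : IsWeakNeumannHalfBall μ ν z R A F G u gu) (hA : ContDiff ℝ 1 A) {lam : ℝ}
    (hlam : 0 < lam) (hell : ∀ y ∈ ball z R, ∀ ξ : H, lam * ‖ξ‖ ^ 2 ≤ ⟪A y ξ, ξ⟫) {r : ℝ}
    (hr : 0 < r) (hrR : r < R) {v : H} (hv : ⟪v, ν⟫ = 0) :
    ∃ gv : H → H, MemLp gv 2 (μ.restrict (halfBall ν z r : Set H)) ∧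
      HasWeakDerivAlong (halfBall ν z r) μ (fun _ => v) gu gv := by
  have hUrU : halfBall ν z r ≤ halfBall ν z R := halfBall_mono hrR.le
  haveI : IsFiniteMeasure (μ.restrict (halfBall ν z r : Set H)) :=
    ⟨by rw [Measure.restrict_apply_univ]; exact measure_halfBall_lt_top μ⟩
  have hguUr : MemLp gu 2 (μ.restrict (halfBall ν z r : Set H)) :=
    hsol.memLp_grad.mono_measure (Measure.restrict_mono_set μ hUrU)
  by_cases hv0 : v = 0
  · subst hv0
    refine ⟨fun _ => 0, memLp_const 0, ?_⟩
    have hI : IntegrableOn gu (halfBall ν z r : Set H) μ := hguUr.integrable (by norm_num)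
    exact
      { locallyIntegrableOn := hI.locallyIntegrableOn
        locallyIntegrableOn_deriv := locallyIntegrableOn_zero
        integral_eq := fun φ hφ => by
          simp [HasWeakDerivAlong.divergence_const_field] }
  · set v₁ : H := ‖v‖⁻¹ • v with hv₁
    have hvn : ‖v‖ ≠ 0 := norm_ne_zero_iff.2 hv0
    have hv₁1 : ‖v₁‖ = 1 := by
      rw [hv₁, norm_smul, norm_inv, norm_norm, inv_mul_cancel₀ hvn]
    have hv₁ν : ⟪v₁, ν⟫ = 0 := by rw [hv₁, real_inner_smul_left, hv, mul_zero]
    obtain ⟨g₁, hm, hd⟩ := hsol.exists_hasWeakDerivAlong_tangential_unit hA hlam hell hr hrR hv₁ν hv₁1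
    refine ⟨fun y => ‖v‖ • g₁ y, hm.const_smul ‖v‖, ?_⟩
    have h := hd.smul_field contDiff_const (ψ := fun _ => ‖v‖) contDiff_const
    have e : (fun _ : H => ‖v‖ • v₁) = fun _ => v := by
      funext
      rw [hv₁, smul_smul, mul_inv_cancel₀ hvn, one_smul]
    rw [e] at h
    exact h

end IsWeakNeumannHalfBall

end Energy

end Literature.Analysis.PDE

end
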